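import Literature.Analysis.FluidPDE.AxisymTransportIBP
import Literature.Analysis.FluidPDE.AxisymOuterBounds
import Literature.Analysis.FluidPDE.AxisymQuotientEquations
import HarnessLib

/-!
# Lei–Zhang 2017, §3: the integral identities behind the `L⁴` estimate of `v^θ`

Analysis/FluidPDE support file (theorems only; no definitions, no named facts) on the discharge
path of the named fact `Literature.Analysis.FluidPDE.LeiZhang2017_logModulus_regularity`
(Lei–Zhang 2017, arXiv:1505.02628, Cor. 1.3). §3, p. 9:

> "by applying standard energy estimate to the equation of `v^θ` in (1.3), it is easy to derive
> `d/dt‖v^θ‖⁴_{L⁴} + ‖∇(v^θ)²‖² + ‖(v^θ)²/r‖² ≤ C|∫ (vʳ/r)(v^θ)⁴/r … |` …"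

In the smooth Hou–Li variables `Φ = v^θ/r = angVelQuot u`, `Γ = r²Φ = swirl u`, `W = vʳ/r`,
`(v^θ)⁴ = Γ²Φ²`, `(v^θ)⁴/r² = ΓΦ³`, `(v^θ)²|∇Φ|² r² = Γ²|∇Φ|²`, the multiplier of the `Φ`-equation
`∂ₜΦ + (u·∇)Φ = ν(Δ + (2/r)∂ᵣ)Φ − 2WΦ` (`IsClassicalNSSolutionOn.angVelQuot_eq`) is `Γ²Φ`, and the
estimate rests on three whole-space integral identities proved here for an axisymmetric
`u ∈ C³`, bounded with bounded derivative and bounded swirl, with `Φ, ∂ᵢΦ, radDerivQuot Φ ∈ L²`: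

* `integral_swirl_sq_angVelQuot_transport` — `∫ Γ²Φ·DΦ[u] = −∫ Γ² W Φ²` (`div u = 0`);
* `integral_swirl_sq_angVelQuot_radDerivQuot` — **`∫ Γ²Φ·(∂ᵣΦ/r) = −∫ ΓΦ³`** (the Hardy-type
  identity `∫ r³Φ⁴ dr = −∫ r⁴Φ³Φᵣ dr`);
* `integral_swirl_angVelQuot_cube_le` — `∫ ΓΦ³ ≤ ∫ Γ²|∇Φ|²`;
* `integral_swirl_sq_angVelQuot_laplacian` — `∫ Γ²Φ·ΔΦ = 4∫ΓΦ³ − 3∫Γ²|∇Φ|²`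
  (for `∂ᵢ∂ᵢΦ ∈ L²` in addition).

## References

* Z. Lei, Q. S. Zhang, Pacific J. Math. 289 (2017) 169–187, arXiv:1505.02628, §3, p. 9.
  [`LeiZhang2017`]
-/

noncomputable section

open MeasureTheory Set Function Filter Topology InnerProductSpace WithLp
open scoped RealInnerProductSpace Laplacian ContDiff ENNReal

namespace Literature.Analysis.FluidPDE

namespace LeiZhang2017

section Pointwise

variable {u : EuclideanSpace ℝ (Fin 3) → EuclideanSpace ℝ (Fin 3)}

/-- `Γ = (x₀² + x₁²) Φ` as functions (`Γ = swirl u`, `Φ = angVelQuot u`, `u ∈ C²` axisymmetric).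
[folklore] -/
theorem swirl_eq_horizSq_mul_angVelQuot (hax : IsAxisymmetric u) (hu : ContDiff ℝ 2 u) :
    swirl u = fun x => (x 0 ^ 2 + x 1 ^ 2) * angVelQuot u x := by
  funext x
  rw [← cylRadius_sq, hax.cylRadius_sq_mul_angVelQuot hu x]

/-- `DΓ(x)h = 2(x₀h₀ + x₁h₁) Φ(x) + (x₀² + x₁²) DΦ(x)h`. [folklore] -/
theorem fderiv_swirl_apply_eq (hax : IsAxisymmetric u) (hu : ContDiff ℝ 3 u)
    (x h : EuclideanSpace ℝ (Fin 3)) :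
    fderiv ℝ (swirl u) x h = 2 * (x 0 * h 0 + x 1 * h 1) * angVelQuot u x +
      (x 0 ^ 2 + x 1 ^ 2) * fderiv ℝ (angVelQuot u) x h := by
  have hΦd : Differentiable ℝ (angVelQuot u) :=
    (contDiff_angVelQuot (n := 1) (by exact_mod_cast hu)).differentiable one_ne_zero
  have hρd : Differentiable ℝ fun y : EuclideanSpace ℝ (Fin 3) => y 0 ^ 2 + y 1 ^ 2 :=
    (contDiff_horizSq (n := 1)).differentiable one_ne_zero
  rw [swirl_eq_horizSq_mul_angVelQuot hax (hu.of_le (by norm_cast)), fderiv_fun_mul (hρd x) (hΦd x)]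
  simp only [_root_.add_apply, _root_.FunLike.coe_smul, Pi.smul_apply, smul_eq_mul, fderiv_rho_apply]
  ring

/-- `|xᵢ Φ(x)| ≤ ‖u(x)‖` for `i = 0, 1` (`r|Φ| = |v^θ| ≤ ‖u‖`). [folklore] -/
theorem abs_coord_mul_angVelQuot_le (hax : IsAxisymmetric u) (hu : ContDiff ℝ 2 u)
    (x : EuclideanSpace ℝ (Fin 3)) {i : Fin 3} (hi : i = 0 ∨ i = 1) :
    |x i * angVelQuot u x| ≤ ‖u x‖ := by
  have hxi : |x i| ≤ cylRadius x := by
    rw [cylRadius]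
    rcases hi with rfl | rfl
    · calc |x 0| = Real.sqrt (x 0 ^ 2) := (Real.sqrt_sq_eq_abs _).symm
        _ ≤ Real.sqrt (x 0 ^ 2 + x 1 ^ 2) := Real.sqrt_le_sqrt (by nlinarith [sq_nonneg (x 1)])
    · calc |x 1| = Real.sqrt (x 1 ^ 2) := (Real.sqrt_sq_eq_abs _).symm
        _ ≤ Real.sqrt (x 0 ^ 2 + x 1 ^ 2) := Real.sqrt_le_sqrt (by nlinarith [sq_nonneg (x 0)])
  have hΓ := hax.cylRadius_sq_mul_angVelQuot hu x
  -- `r |Φ| ≤ ‖u‖`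
  have hrΦ : cylRadius x * |angVelQuot u x| ≤ ‖u x‖ := by
    rcases eq_or_lt_of_le (cylRadius_nonneg x) with h0 | hpos
    · rw [← h0, zero_mul]; exact norm_nonneg _
    · have h1 : cylRadius x * (cylRadius x * |angVelQuot u x|) ≤ cylRadius x * ‖u x‖ := by
        calc cylRadius x * (cylRadius x * |angVelQuot u x|) = |cylRadius x ^ 2 * angVelQuot u x| := by
              rw [abs_mul, abs_of_pos (pow_pos hpos 2)]; ring
          _ = |swirl u x| := by rw [hΓ]
          _ ≤ cylRadius x * ‖u x‖ := abs_swirl_le_cylRadius_mul_norm' x (u x)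
      exact le_of_mul_le_mul_left h1 hpos
  calc |x i * angVelQuot u x| = |x i| * |angVelQuot u x| := abs_mul _ _
    _ ≤ cylRadius x * |angVelQuot u x| := mul_le_mul_of_nonneg_right hxi (abs_nonneg _)
    _ ≤ ‖u x‖ := hrΦ

/-- `(x₀² + x₁²)|Φ(x)| = |Γ(x)|`. [folklore] -/
theorem horizSq_mul_abs_angVelQuot (hax : IsAxisymmetric u) (hu : ContDiff ℝ 2 u)
    (x : EuclideanSpace ℝ (Fin 3)) : (x 0 ^ 2 + x 1 ^ 2) * |angVelQuot u x| = |swirl u x| := by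
  rw [← cylRadius_sq, ← hax.cylRadius_sq_mul_angVelQuot hu x, abs_mul, abs_of_nonneg (sq_nonneg (cylRadius x))]

/-- `x₀∂₀Φ + x₁∂₁Φ = (x₀² + x₁²)·radDerivQuot Φ`. [folklore] -/
theorem coord_mul_fderiv_add_eq (hax : IsAxisymmetric u) (hu : ContDiff ℝ 4 u)
    (x : EuclideanSpace ℝ (Fin 3)) :
    x 0 * fderiv ℝ (angVelQuot u) x (EuclideanSpace.single 0 1) +
      x 1 * fderiv ℝ (angVelQuot u) x (EuclideanSpace.single 1 1) =
      (x 0 ^ 2 + x 1 ^ 2) * radDerivQuot (angVelQuot u) x := by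
  have hΦ2 : ContDiff ℝ 2 (angVelQuot u) := contDiff_angVelQuot (n := 2) (by exact_mod_cast hu)
  have hΦax : IsAxisymmetricScalar (angVelQuot u) := hax.isAxisymmetricScalar_angVelQuot (hu.of_le (by norm_cast))
  rw [← mul_radDerivQuot_eq_fderiv_zero hΦ2 hΦax x, ← mul_radDerivQuot_eq_fderiv_one hΦ2 hΦax x]
  ring

/-- `(x₀² + x₁²)·(radDerivQuot Φ)² ≤ |∇Φ|²` (Cauchy–Schwarz on `x₀∂₀Φ + x₁∂₁Φ`). [folklore] -/
theorem horizSq_mul_radDerivQuot_sq_le (hax : IsAxisymmetric u) (hu : ContDiff ℝ 4 u)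
    (x : EuclideanSpace ℝ (Fin 3)) :
    (x 0 ^ 2 + x 1 ^ 2) * radDerivQuot (angVelQuot u) x ^ 2 ≤
      fderiv ℝ (angVelQuot u) x (EuclideanSpace.single 0 1) ^ 2 +
        fderiv ℝ (angVelQuot u) x (EuclideanSpace.single 1 1) ^ 2 +
        fderiv ℝ (angVelQuot u) x (EuclideanSpace.single 2 1) ^ 2 := by
  have hΦ2 : ContDiff ℝ 2 (angVelQuot u) := contDiff_angVelQuot (n := 2) (by exact_mod_cast hu)
  have hΦax : IsAxisymmetricScalar (angVelQuot u) := hax.isAxisymmetricScalar_angVelQuot (hu.of_le (by norm_cast))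
  have h0 := mul_radDerivQuot_eq_fderiv_zero hΦ2 hΦax x
  have h1 := mul_radDerivQuot_eq_fderiv_one hΦ2 hΦax x
  rw [← h0, ← h1]
  nlinarith [sq_nonneg (fderiv ℝ (angVelQuot u) x (EuclideanSpace.single 2 1)),
    sq_nonneg (x 0 * radDerivQuot (angVelQuot u) x), sq_nonneg (x 1 * radDerivQuot (angVelQuot u) x)]

end Pointwise


section Integral

variable {u : EuclideanSpace ℝ (Fin 3) → EuclideanSpace ℝ (Fin 3)}

/-- The coordinate `xᵢ` of the direction `eⱼ = single j 1` picked by the horizontal pairing: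
`x₀ (eⱼ)₀ + x₁ (eⱼ)₁ = xⱼ` for `j = 0, 1` and `= 0` for `j = 2`; in all cases
`|(x₀ (eⱼ)₀ + x₁ (eⱼ)₁) Φ(x)| ≤ ‖u(x)‖`. [folklore] -/
theorem abs_horizPair_single_mul_angVelQuot_le (hax : IsAxisymmetric u) (hu : ContDiff ℝ 2 u)
    (x : EuclideanSpace ℝ (Fin 3)) (j : Fin 3) :
    |(x 0 * (EuclideanSpace.single j (1 : ℝ) : EuclideanSpace ℝ (Fin 3)) 0 +
        x 1 * (EuclideanSpace.single j (1 : ℝ) : EuclideanSpace ℝ (Fin 3)) 1) * angVelQuot u x| ≤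
      ‖u x‖ := by
  fin_cases j
  · simpa [PiLp.single_apply] using abs_coord_mul_angVelQuot_le hax hu x (i := 0) (Or.inl rfl)
  · simpa [PiLp.single_apply] using abs_coord_mul_angVelQuot_le hax hu x (i := 1) (Or.inr rfl)
  · simp

/-- **The Hardy-type identity `∫ Γ²Φ (∂ᵣΦ/r) = −∫ ΓΦ³`** (`= −∫ (v^θ)⁴/r²`), i.e.
`∫₀^∞ r⁴Φ³Φᵣ dr = −∫₀^∞ r³Φ⁴ dr` fibrewise, proved by two whole-space integrations by parts
against `x₀Γ`, `x₁Γ`. Hypotheses: `u ∈ C⁴` axisymmetric, `‖u‖ ≤ B`, `‖Du‖ ≤ B'`, `|Γ| ≤ M`,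
`Φ, ∂ᵢΦ, radDerivQuot Φ ∈ L²`. [cite: LeiZhang2017, §3, p. 9 (the term `‖r⁻¹(v^θ)²‖²`)] -/
theorem integral_swirl_sq_angVelQuot_radDerivQuot (hax : IsAxisymmetric u) (hu : ContDiff ℝ 4 u)
    {B : ℝ} (huB : ∀ x, ‖u x‖ ≤ B) {B' : ℝ} (hDu : ∀ x, ‖fderiv ℝ u x‖ ≤ B')
    {M : ℝ} (hM : ∀ x, |swirl u x| ≤ M)
    (hΦ0 : MemLp (angVelQuot u) 2 volume)
    (hΦ1 : ∀ i : Fin 3, MemLp (fun x => fderiv ℝ (angVelQuot u) x (EuclideanSpace.single i 1)) 2 volume)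
    (hq : MemLp (radDerivQuot (angVelQuot u)) 2 volume) :
    ∫ x, swirl u x ^ 2 * angVelQuot u x * radDerivQuot (angVelQuot u) x =
      -∫ x, swirl u x * angVelQuot u x ^ 3 := by
  -- names and regularity
  set Φ := angVelQuot u with hΦ
  set Γ := swirl u with hΓ
  set q := radDerivQuot Φ with hq_def
  have hu2 : ContDiff ℝ 2 u := hu.of_le (by norm_cast)
  have hu3 : ContDiff ℝ 3 u := hu.of_le (by norm_cast)
  have hΦc1 : ContDiff ℝ 1 Φ := contDiff_angVelQuot (n := 1) (by exact_mod_cast hu3)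
  have hΦd : Differentiable ℝ Φ := hΦc1.differentiable one_ne_zero
  have hΦc : Continuous Φ := hΦc1.continuous
  have hρc : ContDiff ℝ 1 fun y : EuclideanSpace ℝ (Fin 3) => y 0 ^ 2 + y 1 ^ 2 := contDiff_horizSq
  have hΓeq : Γ = fun x => (x 0 ^ 2 + x 1 ^ 2) * Φ x := swirl_eq_horizSq_mul_angVelQuot hax hu2
  have hΓc1 : ContDiff ℝ 1 Γ := by rw [hΓeq]; exact hρc.mul hΦc1
  have hΓd : Differentiable ℝ Γ := hΓc1.differentiable one_ne_zero
  have hΓc : Continuous Γ := hΓc1.continuous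
  have hqc : Continuous q := (contDiff_radDerivQuot (n := 0) (by
    exact_mod_cast (contDiff_angVelQuot (n := 2) (by exact_mod_cast hu)))).continuous
  have hB0 : 0 ≤ B := (norm_nonneg _).trans (huB 0)
  have hM0 : 0 ≤ M := (abs_nonneg _).trans (hM 0)
  have hB'0 : 0 ≤ B' := (norm_nonneg _).trans (hDu 0)
  have hΦb : ∀ x, |Φ x| ≤ B' := fun x => (hax.abs_angVelQuot_le_norm_fderiv hu2 x).trans (hDu x)
  -- pointwise algebra
  have hΓx : ∀ x, Γ x = (x 0 ^ 2 + x 1 ^ 2) * Φ x := fun x => by rw [hΓeq]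
  have hDΓ : ∀ x h, fderiv ℝ Γ x h = 2 * (x 0 * h 0 + x 1 * h 1) * Φ x +
      (x 0 ^ 2 + x 1 ^ 2) * fderiv ℝ Φ x h := fun x h => fderiv_swirl_apply_eq hax hu3 x h
  have hxq : ∀ x, x 0 * fderiv ℝ Φ x (EuclideanSpace.single 0 1) +
      x 1 * fderiv ℝ Φ x (EuclideanSpace.single 1 1) = (x 0 ^ 2 + x 1 ^ 2) * q x :=
    fun x => coord_mul_fderiv_add_eq hax hu x
  -- basic integrable building blocks: `Φ²`, `|Φ ∂ᵢΦ|`, `|Φ q|`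
  have iΦ2 : Integrable (fun x => Φ x ^ 2) volume := hΦ0.integrable_sq
  have iΦD : ∀ i : Fin 3, Integrable (fun x => Φ x * fderiv ℝ Φ x (EuclideanSpace.single i 1)) volume :=
    fun i => hΦ0.integrable_mul (hΦ1 i)
  have iΦq : Integrable (fun x => Φ x * q x) volume := hΦ0.integrable_mul hq
  -- the integrands of the identity are integrable
  have iX : Integrable (fun x => Γ x ^ 2 * Φ x * q x) volume := by
    refine ((iΦq.norm).const_mul (M ^ 2)).mono'
      (((hΓc.pow 2).mul hΦc).mul hqc).aestronglyMeasurable (Eventually.of_forall fun x => ?_)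
    rw [Real.norm_eq_abs, Real.norm_eq_abs, abs_mul, abs_mul, abs_mul]
    have h1 : |Γ x| ^ 2 ≤ M ^ 2 := pow_le_pow_left₀ (abs_nonneg _) (hM x) 2
    rw [abs_pow]
    nlinarith [abs_nonneg (Φ x), abs_nonneg (q x), mul_nonneg (abs_nonneg (Φ x)) (abs_nonneg (q x))]
  have iP : Integrable (fun x => Γ x * Φ x ^ 3) volume := by
    refine ((iΦ2).const_mul (M * B')).mono' ((hΓc.mul (hΦc.pow 3))).aestronglyMeasurable
      (Eventually.of_forall fun x => ?_)
    rw [Real.norm_eq_abs, abs_mul, abs_pow]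
    have : |Φ x| ^ 3 = |Φ x| * Φ x ^ 2 := by rw [← sq_abs]; ring
    rw [this]
    calc |Γ x| * (|Φ x| * Φ x ^ 2) = (|Γ x| * |Φ x|) * Φ x ^ 2 := by ring
      _ ≤ (M * B') * Φ x ^ 2 :=
          mul_le_mul_of_nonneg_right (mul_le_mul (hM x) (hΦb x) (abs_nonneg _) hM0) (sq_nonneg _)
  -- the two integrations by parts, `j = 0, 1`
  have hIBP : ∀ j : Fin 3, (j = 0 ∨ j = 1) →
      ∫ x, (x j * Γ x) * (3 * Φ x ^ 2 * fderiv ℝ Φ x (EuclideanSpace.single j 1)) =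
        -∫ x, (Γ x + x j * fderiv ℝ Γ x (EuclideanSpace.single j 1)) * Φ x ^ 3 := by
    intro j hj
    set e : EuclideanSpace ℝ (Fin 3) := EuclideanSpace.single j 1 with he
    set ℓ : EuclideanSpace ℝ (Fin 3) →L[ℝ] ℝ := EuclideanSpace.proj j with hℓ
    have hℓ_apply : ∀ y : EuclideanSpace ℝ (Fin 3), ℓ y = y j := fun y => rfl
    have hℓe : ℓ e = 1 := by rw [hℓ_apply, he]; simp
    have hf : Differentiable ℝ fun x : EuclideanSpace ℝ (Fin 3) => x j * Γ x :=
      (ℓ.differentiable).mul hΓd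
    have hg : Differentiable ℝ fun x => Φ x ^ 3 := hΦd.pow 3
    have hDf : ∀ x, fderiv ℝ (fun y : EuclideanSpace ℝ (Fin 3) => y j * Γ y) x e =
        Γ x + x j * fderiv ℝ Γ x e := by
      intro x
      have h2 : HasFDerivAt (fun y : EuclideanSpace ℝ (Fin 3) => y j * Γ y)
          (x j • fderiv ℝ Γ x + Γ x • ℓ) x := (ℓ.hasFDerivAt).mul (hΓd x).hasFDerivAt
      rw [h2.fderiv]
      simp only [_root_.add_apply, _root_.FunLike.coe_smul, Pi.smul_apply, smul_eq_mul, hℓe]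
      ring
    have hDg : ∀ x, fderiv ℝ (fun y => Φ y ^ 3) x e = 3 * Φ x ^ 2 * fderiv ℝ Φ x e := by
      intro x
      rw [((hΦd x).hasFDerivAt.pow 3).fderiv]
      simp [smul_eq_mul]
    -- `|x j Φ| ≤ ‖u‖`
    have hxΦ : ∀ x, |x j * Φ x| ≤ ‖u x‖ := fun x => abs_coord_mul_angVelQuot_le hax hu2 x hj
    have hxj : ∀ x : EuclideanSpace ℝ (Fin 3), x 0 * e 0 + x 1 * e 1 = x j := by
      intro x; rcases hj with rfl | rfl <;> simp [he]
    -- integrability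
    have i1 : Integrable (fun x => fderiv ℝ (fun y : EuclideanSpace ℝ (Fin 3) => y j * Γ y) x e * Φ x ^ 3)
        volume := by
      have hdom : Integrable (fun x => (M * B' + 2 * B ^ 2) * Φ x ^ 2 +
          B * M * |Φ x * fderiv ℝ Φ x e|) volume :=
        (iΦ2.const_mul _).add ((iΦD j).norm.const_mul _)
      have hmeas : AEStronglyMeasurable
          (fun x => fderiv ℝ (fun y : EuclideanSpace ℝ (Fin 3) => y j * Γ y) x e * Φ x ^ 3) volume := by
        have : Continuous fun x => (Γ x + x j * fderiv ℝ Γ x e) * Φ x ^ 3 :=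
          (hΓc.add ((ℓ.continuous).mul ((hΓc1.continuous_fderiv one_ne_zero).clm_apply
            continuous_const))).mul (hΦc.pow 3)
        exact (this.aestronglyMeasurable).congr (Eventually.of_forall fun x => by
          simp only; rw [hDf x])
      refine hdom.mono' hmeas (Eventually.of_forall fun x => ?_)
      rw [hDf x, hDΓ x e, hxj x, Real.norm_eq_abs]
      -- the integrand: `Γ Φ³ + 2 xⱼ² Φ⁴ + xⱼ ρ ∂Φ Φ³`
      have e1 : (Γ x + x j * (2 * x j * Φ x + (x 0 ^ 2 + x 1 ^ 2) * fderiv ℝ Φ x e)) * Φ x ^ 3 =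
          Γ x * Φ x * Φ x ^ 2 + 2 * (x j * Φ x) ^ 2 * Φ x ^ 2 +
            (x j * Φ x) * Γ x * (Φ x * fderiv ℝ Φ x e) := by
        rw [hΓx x]; ring
      rw [e1]
      have t1 : |Γ x * Φ x * Φ x ^ 2| ≤ M * B' * Φ x ^ 2 := by
        rw [abs_mul, abs_mul, abs_of_nonneg (sq_nonneg (Φ x))]
        exact mul_le_mul_of_nonneg_right (mul_le_mul (hM x) (hΦb x) (abs_nonneg _) hM0) (sq_nonneg _)
      have t2 : |2 * (x j * Φ x) ^ 2 * Φ x ^ 2| ≤ 2 * B ^ 2 * Φ x ^ 2 := by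
        rw [abs_of_nonneg (by positivity)]
        have : (x j * Φ x) ^ 2 ≤ B ^ 2 := by
          calc (x j * Φ x) ^ 2 = |x j * Φ x| ^ 2 := (sq_abs _).symm
            _ ≤ B ^ 2 := pow_le_pow_left₀ (abs_nonneg _) ((hxΦ x).trans (huB x)) 2
        nlinarith [sq_nonneg (Φ x)]
      have t3 : |(x j * Φ x) * Γ x * (Φ x * fderiv ℝ Φ x e)| ≤ B * M * |Φ x * fderiv ℝ Φ x e| := by
        rw [abs_mul, abs_mul]
        exact mul_le_mul_of_nonneg_right (mul_le_mul ((hxΦ x).trans (huB x)) (hM x) (abs_nonneg _) hB0)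
          (abs_nonneg _)
      calc |Γ x * Φ x * Φ x ^ 2 + 2 * (x j * Φ x) ^ 2 * Φ x ^ 2 + x j * Φ x * Γ x * (Φ x * fderiv ℝ Φ x e)|
          ≤ |Γ x * Φ x * Φ x ^ 2| + |2 * (x j * Φ x) ^ 2 * Φ x ^ 2| +
              |x j * Φ x * Γ x * (Φ x * fderiv ℝ Φ x e)| := abs_add_three _ _ _
        _ ≤ M * B' * Φ x ^ 2 + 2 * B ^ 2 * Φ x ^ 2 + B * M * |Φ x * fderiv ℝ Φ x e| := by linarith
        _ = (M * B' + 2 * B ^ 2) * Φ x ^ 2 + B * M * |Φ x * fderiv ℝ Φ x e| := by ring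
    have i2 : Integrable (fun x => (x j * Γ x) * fderiv ℝ (fun y => Φ y ^ 3) x e) volume := by
      have hdom : Integrable (fun x => 3 * (B * M) * |Φ x * fderiv ℝ Φ x e|) volume :=
        (iΦD j).norm.const_mul _
      have hmeas : AEStronglyMeasurable (fun x => (x j * Γ x) * fderiv ℝ (fun y => Φ y ^ 3) x e) volume := by
        have : Continuous fun x => (x j * Γ x) * (3 * Φ x ^ 2 * fderiv ℝ Φ x e) :=
          ((ℓ.continuous).mul hΓc).mul (((hΦc.pow 2).const_mul 3).mul
            ((hΦc1.continuous_fderiv one_ne_zero).clm_apply continuous_const))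
        exact this.aestronglyMeasurable.congr (Eventually.of_forall fun x => by simp only; rw [hDg x])
      refine hdom.mono' hmeas (Eventually.of_forall fun x => ?_)
      rw [hDg x, Real.norm_eq_abs]
      have : x j * Γ x * (3 * Φ x ^ 2 * fderiv ℝ Φ x e) = 3 * ((x j * Φ x) * Γ x * (Φ x * fderiv ℝ Φ x e)) := by
        ring
      rw [this, abs_mul, abs_of_pos (by norm_num : (0:ℝ) < 3), abs_mul, abs_mul]
      have := mul_le_mul ((hxΦ x).trans (huB x)) (hM x) (abs_nonneg _) hB0
      nlinarith [abs_nonneg (Φ x * fderiv ℝ Φ x e), abs_nonneg (x j * Φ x), abs_nonneg (Γ x)]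
    have i3 : Integrable (fun x => (x j * Γ x) * Φ x ^ 3) volume := by
      have hdom : Integrable (fun x => (B * M) * Φ x ^ 2) volume := iΦ2.const_mul _
      refine hdom.mono' (((ℓ.continuous).mul hΓc).mul (hΦc.pow 3)).aestronglyMeasurable
        (Eventually.of_forall fun x => ?_)
      rw [Real.norm_eq_abs]
      have : x j * Γ x * Φ x ^ 3 = ((x j * Φ x) * Γ x) * Φ x ^ 2 := by ring
      rw [this, abs_mul, abs_of_nonneg (sq_nonneg (Φ x)), abs_mul]
      exact mul_le_mul_of_nonneg_right (mul_le_mul ((hxΦ x).trans (huB x)) (hM x)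
        (abs_nonneg _) hB0) (sq_nonneg _)
    have hibp := integral_mul_fderiv_eq_neg_fderiv_mul_of_integrable (μ := volume)
      (f := fun y : EuclideanSpace ℝ (Fin 3) => y j * Γ y) (g := fun y => Φ y ^ 3) (v := e) i1 i2 i3
      (fun x _ => hf x) (fun x _ => hg x)
    have hL : ∫ x, (x j * Γ x) * (3 * Φ x ^ 2 * fderiv ℝ Φ x e) =
        ∫ x, (x j * Γ x) * fderiv ℝ (fun y => Φ y ^ 3) x e :=
      integral_congr_ae (Eventually.of_forall fun x => by simp only; rw [hDg x])
    have hR : ∫ x, fderiv ℝ (fun y : EuclideanSpace ℝ (Fin 3) => y j * Γ y) x e * Φ x ^ 3 =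
        ∫ x, (Γ x + x j * fderiv ℝ Γ x e) * Φ x ^ 3 :=
      integral_congr_ae (Eventually.of_forall fun x => by simp only; rw [hDf x])
    rw [hL, hibp, hR]
  -- sum of the two identities: left sides give `3X`, right sides `−(4P + X)`
  have h0 := hIBP 0 (Or.inl rfl)
  have h1 := hIBP 1 (Or.inr rfl)
  -- integrable pieces for splitting
  have iL : ∀ j : Fin 3, (j = 0 ∨ j = 1) → Integrable (fun x => (x j * Γ x) *
      (3 * Φ x ^ 2 * fderiv ℝ Φ x (EuclideanSpace.single j 1))) volume := by
    intro j hj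
    have hxΦ : ∀ x, |x j * Φ x| ≤ ‖u x‖ := fun x => abs_coord_mul_angVelQuot_le hax hu2 x hj
    have hdom : Integrable (fun x => 3 * (B * M) * |Φ x * fderiv ℝ Φ x (EuclideanSpace.single j 1)|)
        volume := (iΦD j).norm.const_mul _
    refine hdom.mono' ((((EuclideanSpace.proj j).continuous).mul hΓc).mul
      (((hΦc.pow 2).const_mul 3).mul ((hΦc1.continuous_fderiv one_ne_zero).clm_apply
        continuous_const))).aestronglyMeasurable (Eventually.of_forall fun x => ?_)
    rw [Real.norm_eq_abs]
    have : x j * Γ x * (3 * Φ x ^ 2 * fderiv ℝ Φ x (EuclideanSpace.single j 1)) =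
        3 * ((x j * Φ x) * Γ x * (Φ x * fderiv ℝ Φ x (EuclideanSpace.single j 1))) := by ring
    rw [this, abs_mul, abs_of_pos (by norm_num : (0:ℝ) < 3), abs_mul, abs_mul]
    have := mul_le_mul ((hxΦ x).trans (huB x)) (hM x) (abs_nonneg _) hB0
    nlinarith [abs_nonneg (Φ x * fderiv ℝ Φ x (EuclideanSpace.single j 1)), abs_nonneg (x j * Φ x),
      abs_nonneg (Γ x)]
  have iR : ∀ j : Fin 3, (j = 0 ∨ j = 1) → Integrable (fun x =>
      (Γ x + x j * fderiv ℝ Γ x (EuclideanSpace.single j 1)) * Φ x ^ 3) volume := by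
    intro j hj
    -- `(Γ + xⱼ ∂ⱼΓ) Φ³ = ΓΦ³ + 2 xⱼ²Φ⁴ + xⱼΓ Φ² ∂ⱼΦ·ρ/…` : dominate as in `i1`
    have hxΦ : ∀ x, |x j * Φ x| ≤ ‖u x‖ := fun x => abs_coord_mul_angVelQuot_le hax hu2 x hj
    have hxj : ∀ x : EuclideanSpace ℝ (Fin 3), x 0 * (EuclideanSpace.single j (1:ℝ) : EuclideanSpace ℝ (Fin 3)) 0 +
        x 1 * (EuclideanSpace.single j (1:ℝ) : EuclideanSpace ℝ (Fin 3)) 1 = x j := by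
      intro x; rcases hj with rfl | rfl <;> simp
    have hdom : Integrable (fun x => (M * B' + 2 * B ^ 2) * Φ x ^ 2 +
        B * M * |Φ x * fderiv ℝ Φ x (EuclideanSpace.single j 1)|) volume :=
      (iΦ2.const_mul _).add ((iΦD j).norm.const_mul _)
    refine hdom.mono' ((hΓc.add (((EuclideanSpace.proj j).continuous).mul
      ((hΓc1.continuous_fderiv one_ne_zero).clm_apply continuous_const))).mul (hΦc.pow 3)).aestronglyMeasurable
      (Eventually.of_forall fun x => ?_)
    rw [hDΓ x, hxj x, Real.norm_eq_abs]
    have e1 : (Γ x + x j * (2 * x j * Φ x + (x 0 ^ 2 + x 1 ^ 2) * fderiv ℝ Φ x (EuclideanSpace.single j 1))) *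
        Φ x ^ 3 = Γ x * Φ x * Φ x ^ 2 + 2 * (x j * Φ x) ^ 2 * Φ x ^ 2 +
          (x j * Φ x) * Γ x * (Φ x * fderiv ℝ Φ x (EuclideanSpace.single j 1)) := by
      rw [hΓx x]; ring
    rw [e1]
    have t1 : |Γ x * Φ x * Φ x ^ 2| ≤ M * B' * Φ x ^ 2 := by
      rw [abs_mul, abs_mul, abs_of_nonneg (sq_nonneg (Φ x))]
      exact mul_le_mul_of_nonneg_right (mul_le_mul (hM x) (hΦb x) (abs_nonneg _) hM0) (sq_nonneg _)
    have t2 : |2 * (x j * Φ x) ^ 2 * Φ x ^ 2| ≤ 2 * B ^ 2 * Φ x ^ 2 := by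
      rw [abs_of_nonneg (by positivity)]
      have : (x j * Φ x) ^ 2 ≤ B ^ 2 := by
        calc (x j * Φ x) ^ 2 = |x j * Φ x| ^ 2 := (sq_abs _).symm
          _ ≤ B ^ 2 := pow_le_pow_left₀ (abs_nonneg _) ((hxΦ x).trans (huB x)) 2
      nlinarith [sq_nonneg (Φ x)]
    have t3 : |(x j * Φ x) * Γ x * (Φ x * fderiv ℝ Φ x (EuclideanSpace.single j 1))| ≤
        B * M * |Φ x * fderiv ℝ Φ x (EuclideanSpace.single j 1)| := by
      rw [abs_mul, abs_mul]
      exact mul_le_mul_of_nonneg_right (mul_le_mul ((hxΦ x).trans (huB x)) (hM x) (abs_nonneg _) hB0)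
        (abs_nonneg _)
    calc |Γ x * Φ x * Φ x ^ 2 + 2 * (x j * Φ x) ^ 2 * Φ x ^ 2 +
          x j * Φ x * Γ x * (Φ x * fderiv ℝ Φ x (EuclideanSpace.single j 1))|
        ≤ |Γ x * Φ x * Φ x ^ 2| + |2 * (x j * Φ x) ^ 2 * Φ x ^ 2| +
            |x j * Φ x * Γ x * (Φ x * fderiv ℝ Φ x (EuclideanSpace.single j 1))| := abs_add_three _ _ _
      _ ≤ M * B' * Φ x ^ 2 + 2 * B ^ 2 * Φ x ^ 2 + B * M * |Φ x * fderiv ℝ Φ x (EuclideanSpace.single j 1)| := by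
          linarith
      _ = (M * B' + 2 * B ^ 2) * Φ x ^ 2 + B * M * |Φ x * fderiv ℝ Φ x (EuclideanSpace.single j 1)| := by ring
  -- pointwise sums
  have hsumL : ∀ x, (x 0 * Γ x) * (3 * Φ x ^ 2 * fderiv ℝ Φ x (EuclideanSpace.single 0 1)) +
      (x 1 * Γ x) * (3 * Φ x ^ 2 * fderiv ℝ Φ x (EuclideanSpace.single 1 1)) =
      3 * (Γ x ^ 2 * Φ x * q x) := by
    intro x
    have e1 : (x 0 * Γ x) * (3 * Φ x ^ 2 * fderiv ℝ Φ x (EuclideanSpace.single 0 1)) +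
        (x 1 * Γ x) * (3 * Φ x ^ 2 * fderiv ℝ Φ x (EuclideanSpace.single 1 1)) =
        3 * Γ x * Φ x ^ 2 * (x 0 * fderiv ℝ Φ x (EuclideanSpace.single 0 1) +
          x 1 * fderiv ℝ Φ x (EuclideanSpace.single 1 1)) := by ring
    rw [e1, hxq x, hΓx x]
    ring
  have hsumR : ∀ x, (Γ x + x 0 * fderiv ℝ Γ x (EuclideanSpace.single 0 1)) * Φ x ^ 3 +
      (Γ x + x 1 * fderiv ℝ Γ x (EuclideanSpace.single 1 1)) * Φ x ^ 3 =
      4 * (Γ x * Φ x ^ 3) + Γ x ^ 2 * Φ x * q x := by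
    intro x
    rw [hDΓ x, hDΓ x]
    simp only [PiLp.single_apply]
    simp only [Fin.isValue, ↓reduceIte, one_ne_zero, zero_ne_one, mul_one, mul_zero, add_zero, zero_add]
    have e1 : (Γ x + x 0 * (2 * (x 0) * Φ x + (x 0 ^ 2 + x 1 ^ 2) * fderiv ℝ Φ x (EuclideanSpace.single 0 1))) *
        Φ x ^ 3 + (Γ x + x 1 * (2 * (x 1) * Φ x + (x 0 ^ 2 + x 1 ^ 2) *
          fderiv ℝ Φ x (EuclideanSpace.single 1 1))) * Φ x ^ 3 =
        2 * Γ x * Φ x ^ 3 + 2 * ((x 0 ^ 2 + x 1 ^ 2) * Φ x) * Φ x ^ 3 +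
          (x 0 ^ 2 + x 1 ^ 2) * Φ x ^ 3 * (x 0 * fderiv ℝ Φ x (EuclideanSpace.single 0 1) +
            x 1 * fderiv ℝ Φ x (EuclideanSpace.single 1 1)) := by ring
    rw [e1, hxq x, hΓx x]
    ring
  -- integrate
  have eL : (∫ x, (x 0 * Γ x) * (3 * Φ x ^ 2 * fderiv ℝ Φ x (EuclideanSpace.single 0 1))) +
      (∫ x, (x 1 * Γ x) * (3 * Φ x ^ 2 * fderiv ℝ Φ x (EuclideanSpace.single 1 1))) =
      3 * ∫ x, Γ x ^ 2 * Φ x * q x := by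
    rw [← integral_add (iL 0 (Or.inl rfl)) (iL 1 (Or.inr rfl)), ← integral_const_mul]
    exact integral_congr_ae (Eventually.of_forall fun x => hsumL x)
  have eR : (∫ x, (Γ x + x 0 * fderiv ℝ Γ x (EuclideanSpace.single 0 1)) * Φ x ^ 3) +
      (∫ x, (Γ x + x 1 * fderiv ℝ Γ x (EuclideanSpace.single 1 1)) * Φ x ^ 3) =
      4 * (∫ x, Γ x * Φ x ^ 3) + ∫ x, Γ x ^ 2 * Φ x * q x := by
    rw [← integral_add (iR 0 (Or.inl rfl)) (iR 1 (Or.inr rfl)), ← integral_const_mul,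
      ← integral_add (iP.const_mul 4) iX]
    exact integral_congr_ae (Eventually.of_forall fun x => by simp only; rw [hsumR x])
  have key : 3 * (∫ x, Γ x ^ 2 * Φ x * q x) = -(4 * (∫ x, Γ x * Φ x ^ 3) + ∫ x, Γ x ^ 2 * Φ x * q x) := by
    rw [← eL, ← eR, h0, h1]; ring
  linarith

/-- **`∫ ΓΦ³ ≤ ∫ Γ²|∇Φ|²`** (`∫ (v^θ)⁴/r² ≤ ∫ (v^θ)²|∇Φ|² r²`): from the Hardy-type identity
`∫ ΓΦ³ = −∫ Γ²Φ(∂ᵣΦ/r)` and `2|Γ²Φ(∂ᵣΦ/r)| ≤ ΓΦ³ + Γ²|∇Φ|²` pointwise. Hypotheses as in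
`integral_swirl_sq_angVelQuot_radDerivQuot`. [cite: LeiZhang2017, §3, p. 9] -/
theorem integral_swirl_angVelQuot_cube_le (hax : IsAxisymmetric u) (hu : ContDiff ℝ 4 u)
    {B : ℝ} (huB : ∀ x, ‖u x‖ ≤ B) {B' : ℝ} (hDu : ∀ x, ‖fderiv ℝ u x‖ ≤ B')
    {M : ℝ} (hM : ∀ x, |swirl u x| ≤ M)
    (hΦ0 : MemLp (angVelQuot u) 2 volume)
    (hΦ1 : ∀ i : Fin 3, MemLp (fun x => fderiv ℝ (angVelQuot u) x (EuclideanSpace.single i 1)) 2 volume)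
    (hq : MemLp (radDerivQuot (angVelQuot u)) 2 volume) :
    ∫ x, swirl u x * angVelQuot u x ^ 3 ≤
      ∫ x, swirl u x ^ 2 * (fderiv ℝ (angVelQuot u) x (EuclideanSpace.single 0 1) ^ 2 +
        fderiv ℝ (angVelQuot u) x (EuclideanSpace.single 1 1) ^ 2 +
        fderiv ℝ (angVelQuot u) x (EuclideanSpace.single 2 1) ^ 2) := by
  set Φ := angVelQuot u with hΦ
  set Γ := swirl u with hΓ
  set q := radDerivQuot Φ with hq_def
  set g2 : EuclideanSpace ℝ (Fin 3) → ℝ := fun x => fderiv ℝ Φ x (EuclideanSpace.single 0 1) ^ 2 +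
    fderiv ℝ Φ x (EuclideanSpace.single 1 1) ^ 2 + fderiv ℝ Φ x (EuclideanSpace.single 2 1) ^ 2 with hg2
  have hu2 : ContDiff ℝ 2 u := hu.of_le (by norm_cast)
  have hu3 : ContDiff ℝ 3 u := hu.of_le (by norm_cast)
  have hΦc1 : ContDiff ℝ 1 Φ := contDiff_angVelQuot (n := 1) (by exact_mod_cast hu3)
  have hΦc : Continuous Φ := hΦc1.continuous
  have hΓeq : Γ = fun x => (x 0 ^ 2 + x 1 ^ 2) * Φ x := swirl_eq_horizSq_mul_angVelQuot hax hu2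
  have hΓx : ∀ x, Γ x = (x 0 ^ 2 + x 1 ^ 2) * Φ x := fun x => by rw [hΓeq]
  have hΓc : Continuous Γ := by rw [hΓeq]; exact (contDiff_horizSq (n := 0)).continuous.mul hΦc
  have hqc : Continuous q := (contDiff_radDerivQuot (n := 0) (by
    exact_mod_cast (contDiff_angVelQuot (n := 2) (by exact_mod_cast hu)))).continuous
  have hg2c : Continuous g2 := by
    have hD : Continuous (fderiv ℝ Φ) := hΦc1.continuous_fderiv one_ne_zero
    simp only [hg2]
    fun_prop
  have hM0 : 0 ≤ M := (abs_nonneg _).trans (hM 0)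
  have hB'0 : 0 ≤ B' := (norm_nonneg _).trans (hDu 0)
  have hΦb : ∀ x, |Φ x| ≤ B' := fun x => (hax.abs_angVelQuot_le_norm_fderiv hu2 x).trans (hDu x)
  -- the identity `X = −P`
  have hX := integral_swirl_sq_angVelQuot_radDerivQuot hax hu huB hDu hM hΦ0 hΦ1 hq
  -- integrability
  have iΦ2 : Integrable (fun x => Φ x ^ 2) volume := hΦ0.integrable_sq
  have iΦq : Integrable (fun x => Φ x * q x) volume := hΦ0.integrable_mul hq
  have ig2 : Integrable g2 volume :=
    ((hΦ1 0).integrable_sq.add (hΦ1 1).integrable_sq).add (hΦ1 2).integrable_sq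
  have iX : Integrable (fun x => Γ x ^ 2 * Φ x * q x) volume := by
    refine ((iΦq.norm).const_mul (M ^ 2)).mono'
      (((hΓc.pow 2).mul hΦc).mul hqc).aestronglyMeasurable (Eventually.of_forall fun x => ?_)
    rw [Real.norm_eq_abs, Real.norm_eq_abs, abs_mul, abs_mul, abs_mul]
    have h1 : |Γ x| ^ 2 ≤ M ^ 2 := pow_le_pow_left₀ (abs_nonneg _) (hM x) 2
    rw [abs_pow]
    nlinarith [abs_nonneg (Φ x), abs_nonneg (q x), mul_nonneg (abs_nonneg (Φ x)) (abs_nonneg (q x))]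
  have iP : Integrable (fun x => Γ x * Φ x ^ 3) volume := by
    refine ((iΦ2).const_mul (M * B')).mono' ((hΓc.mul (hΦc.pow 3))).aestronglyMeasurable
      (Eventually.of_forall fun x => ?_)
    rw [Real.norm_eq_abs, abs_mul, abs_pow]
    have : |Φ x| ^ 3 = |Φ x| * Φ x ^ 2 := by rw [← sq_abs]; ring
    rw [this]
    calc |Γ x| * (|Φ x| * Φ x ^ 2) = (|Γ x| * |Φ x|) * Φ x ^ 2 := by ring
      _ ≤ (M * B') * Φ x ^ 2 :=
          mul_le_mul_of_nonneg_right (mul_le_mul (hM x) (hΦb x) (abs_nonneg _) hM0) (sq_nonneg _)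
  have iD : Integrable (fun x => Γ x ^ 2 * g2 x) volume := by
    refine (ig2.const_mul (M ^ 2)).mono' ((hΓc.pow 2).mul hg2c).aestronglyMeasurable
      (Eventually.of_forall fun x => ?_)
    have hg0 : 0 ≤ g2 x := by simp only [hg2]; positivity
    rw [Real.norm_eq_abs, abs_mul, abs_of_nonneg hg0, abs_pow]
    exact mul_le_mul_of_nonneg_right (pow_le_pow_left₀ (abs_nonneg _) (hM x) 2) hg0
  -- pointwise Young: `2|Γ²Φq| ≤ ΓΦ³ + Γ² g2`
  have hpt : ∀ x, |Γ x ^ 2 * Φ x * q x| ≤ (1 / 2) * (Γ x * Φ x ^ 3) + (1 / 2) * (Γ x ^ 2 * g2 x) := by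
    intro x
    set ρ : ℝ := x 0 ^ 2 + x 1 ^ 2 with hρ
    have hρ0 : 0 ≤ ρ := by positivity
    have hg0 : 0 ≤ g2 x := by simp only [hg2]; positivity
    have hr : cylRadius x = Real.sqrt ρ := rfl
    -- `(ρ q)² ≤ ρ g2`
    have hq2 : ρ * q x ^ 2 ≤ g2 x := horizSq_mul_radDerivQuot_sq_le hax hu x
    have hρq : |ρ * q x| ≤ Real.sqrt ρ * Real.sqrt (g2 x) := by
      rw [← Real.sqrt_mul hρ0]
      refine Real.abs_le_sqrt ?_
      calc (ρ * q x) ^ 2 = ρ * (ρ * q x ^ 2) := by ring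
        _ ≤ ρ * g2 x := mul_le_mul_of_nonneg_left hq2 hρ0
    -- `Γ²Φq = (ΓΦ²)(ρ q)`
    have e1 : Γ x ^ 2 * Φ x * q x = (Γ x * Φ x ^ 2) * (ρ * q x) := by
      rw [sq, hΓx x, ← hρ]; ring
    rw [e1, abs_mul, abs_mul, abs_of_nonneg (sq_nonneg (Φ x))]
    · -- `|Γ| Φ² · |ρq| ≤ |Γ| Φ² · √ρ √g2 = (√ρ Φ²)(|Γ| √g2) ≤ ½(ρΦ⁴ + Γ² g2)`
      have hY : 2 * (Real.sqrt ρ * Φ x ^ 2) * (|Γ x| * Real.sqrt (g2 x)) ≤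
          (Real.sqrt ρ * Φ x ^ 2) ^ 2 + (|Γ x| * Real.sqrt (g2 x)) ^ 2 :=
        two_mul_le_add_sq _ _
      have e2 : (Real.sqrt ρ * Φ x ^ 2) ^ 2 = Γ x * Φ x ^ 3 := by
        rw [mul_pow, Real.sq_sqrt hρ0, hΓx x, ← hρ]; ring
      have e3 : (|Γ x| * Real.sqrt (g2 x)) ^ 2 = Γ x ^ 2 * g2 x := by
        rw [mul_pow, Real.sq_sqrt hg0, sq_abs]
      have h4 : |Γ x| * Φ x ^ 2 * |ρ * q x| ≤ (Real.sqrt ρ * Φ x ^ 2) * (|Γ x| * Real.sqrt (g2 x)) := by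
        calc |Γ x| * Φ x ^ 2 * |ρ * q x| ≤ |Γ x| * Φ x ^ 2 * (Real.sqrt ρ * Real.sqrt (g2 x)) :=
              mul_le_mul_of_nonneg_left hρq (by positivity)
          _ = (Real.sqrt ρ * Φ x ^ 2) * (|Γ x| * Real.sqrt (g2 x)) := by ring
      linarith
  -- conclude
  have hP : ∫ x, Γ x * Φ x ^ 3 = -∫ x, Γ x ^ 2 * Φ x * q x := by rw [hX]; ring
  have h1 : -∫ x, Γ x ^ 2 * Φ x * q x ≤ ∫ x, |Γ x ^ 2 * Φ x * q x| := by
    rw [← integral_neg]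
    refine integral_mono iX.neg iX.abs fun x => ?_
    exact neg_le_abs (Γ x ^ 2 * Φ x * q x)
  have h2 : ∫ x, |Γ x ^ 2 * Φ x * q x| ≤ (1 / 2) * (∫ x, Γ x * Φ x ^ 3) + (1 / 2) * ∫ x, Γ x ^ 2 * g2 x := by
    rw [← integral_const_mul, ← integral_const_mul, ← integral_add (iP.const_mul _) (iD.const_mul _)]
    exact integral_mono iX.abs ((iP.const_mul _).add (iD.const_mul _)) hpt
  have h3 : ∫ x, Γ x * Φ x ^ 3 ≤ (1 / 2) * (∫ x, Γ x * Φ x ^ 3) + (1 / 2) * ∫ x, Γ x ^ 2 * g2 x := by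
    rw [hP]; exact h1.trans (hP ▸ h2)
  linarith

/-- **Transport: `∫ Γ²Φ·DΦ[u] = −∫ Γ² W Φ²`** (`W = radVelQuot u`; `div u = 0`, the transport
integration by parts `∫ a·Db[u] = −∫ Da[u]·b` with `a = Γ²Φ`, `b = Φ`, and
`DΓ[u] = 2ρWΦ + ρDΦ[u]`). Hypotheses: `u ∈ C⁴` axisymmetric divergence-free, `‖u‖ ≤ B`,
`‖Du‖ ≤ B'`, `|Γ| ≤ M`, `Φ, ∂ᵢΦ ∈ L²`. [cite: LeiZhang2017, §3, p. 9] -/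
theorem integral_swirl_sq_angVelQuot_transport (hax : IsAxisymmetric u) (hu : ContDiff ℝ 4 u)
    (hdiv : VectorCalculus.IsDivFree u)
    {B : ℝ} (huB : ∀ x, ‖u x‖ ≤ B) {B' : ℝ} (hDu : ∀ x, ‖fderiv ℝ u x‖ ≤ B')
    {M : ℝ} (hM : ∀ x, |swirl u x| ≤ M)
    (hΦ0 : MemLp (angVelQuot u) 2 volume)
    (hΦ1 : ∀ i : Fin 3, MemLp (fun x => fderiv ℝ (angVelQuot u) x (EuclideanSpace.single i 1)) 2 volume) :
    ∫ x, swirl u x ^ 2 * angVelQuot u x * fderiv ℝ (angVelQuot u) x (u x) =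
      -∫ x, swirl u x ^ 2 * radVelQuot u x * angVelQuot u x ^ 2 := by
  set Φ := angVelQuot u with hΦ
  set Γ := swirl u with hΓ
  set W := radVelQuot u with hW
  have hu1 : ContDiff ℝ 1 u := hu.of_le (by norm_cast)
  have hu2 : ContDiff ℝ 2 u := hu.of_le (by norm_cast)
  have hu3 : ContDiff ℝ 3 u := hu.of_le (by norm_cast)
  have hΦc1 : ContDiff ℝ 1 Φ := contDiff_angVelQuot (n := 1) (by exact_mod_cast hu3)
  have hΦd : Differentiable ℝ Φ := hΦc1.differentiable one_ne_zero
  have hΦc : Continuous Φ := hΦc1.continuous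
  have hDΦc : Continuous (fderiv ℝ Φ) := hΦc1.continuous_fderiv one_ne_zero
  have hΓeq : Γ = fun x => (x 0 ^ 2 + x 1 ^ 2) * Φ x := swirl_eq_horizSq_mul_angVelQuot hax hu2
  have hΓx : ∀ x, Γ x = (x 0 ^ 2 + x 1 ^ 2) * Φ x := fun x => by rw [hΓeq]
  have hΓc1 : ContDiff ℝ 1 Γ := by rw [hΓeq]; exact contDiff_horizSq.mul hΦc1
  have hΓd : Differentiable ℝ Γ := hΓc1.differentiable one_ne_zero
  have hΓc : Continuous Γ := hΓc1.continuous
  have hWc : Continuous W := (contDiff_radVelQuot (n := 0) (by exact_mod_cast hu2)).continuous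
  have hM0 : 0 ≤ M := (abs_nonneg _).trans (hM 0)
  have hB0 : 0 ≤ B := (norm_nonneg _).trans (huB 0)
  have hB'0 : 0 ≤ B' := (norm_nonneg _).trans (hDu 0)
  have hΦb : ∀ x, |Φ x| ≤ B' := fun x => (hax.abs_angVelQuot_le_norm_fderiv hu2 x).trans (hDu x)
  have hWb : ∀ x, |W x| ≤ B' := fun x => (hax.abs_radVelQuot_le_norm_fderiv hu2 x).trans (hDu x)
  have hDΓ : ∀ x h, fderiv ℝ Γ x h = 2 * (x 0 * h 0 + x 1 * h 1) * Φ x +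
      (x 0 ^ 2 + x 1 ^ 2) * fderiv ℝ Φ x h := fun x h => fderiv_swirl_apply_eq hax hu3 x h
  have hxu : ∀ x, x 0 * u x 0 + x 1 * u x 1 = (x 0 ^ 2 + x 1 ^ 2) * W x := fun x => by
    rw [← cylRadius_sq, hax.cylRadius_sq_mul_radVelQuot hu2 x]
  -- the multiplier `a = Γ²Φ`
  set a : EuclideanSpace ℝ (Fin 3) → ℝ := fun x => Γ x ^ 2 * Φ x with ha_def
  have ha1 : ContDiff ℝ 1 a := (hΓc1.pow 2).mul hΦc1
  have hDa : ∀ x h, fderiv ℝ a x h = Γ x ^ 2 * fderiv ℝ Φ x h + Φ x * (2 * Γ x * fderiv ℝ Γ x h) := by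
    intro x h
    have h1 := ((hΓd x).hasFDerivAt.pow 2).mul (hΦd x).hasFDerivAt
    rw [show a = (fun y => Γ y ^ 2) * Φ from rfl, h1.fderiv]
    simp only [_root_.add_apply, _root_.FunLike.coe_smul, Pi.smul_apply, smul_eq_mul]
    push_cast
    ring
  -- integrable building blocks
  have iΦ2 : Integrable (fun x => Φ x ^ 2) volume := hΦ0.integrable_sq
  have iΦD : ∀ i : Fin 3, Integrable (fun x => Φ x * fderiv ℝ Φ x (EuclideanSpace.single i 1)) volume :=
    fun i => hΦ0.integrable_mul (hΦ1 i)
  have hab : Integrable (fun x => a x * Φ x) volume := by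
    refine (iΦ2.const_mul (M ^ 2)).mono' (ha1.continuous.mul hΦc).aestronglyMeasurable
      (Eventually.of_forall fun x => ?_)
    rw [Real.norm_eq_abs]
    have : a x * Φ x = Γ x ^ 2 * Φ x ^ 2 := by simp only [ha_def]; ring
    rw [this, abs_of_nonneg (by positivity)]
    have h1 : Γ x ^ 2 ≤ M ^ 2 := by
      rw [← sq_abs]; exact pow_le_pow_left₀ (abs_nonneg _) (hM x) 2
    exact mul_le_mul_of_nonneg_right h1 (sq_nonneg _)
  have haDb : ∀ i : Fin 3, Integrable (fun x => a x * fderiv ℝ Φ x (EuclideanSpace.single i 1)) volume := by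
    intro i
    refine ((iΦD i).norm.const_mul (M ^ 2)).mono' (ha1.continuous.mul (hDΦc.clm_apply
      continuous_const)).aestronglyMeasurable (Eventually.of_forall fun x => ?_)
    rw [Real.norm_eq_abs, Real.norm_eq_abs]
    have : a x * fderiv ℝ Φ x (EuclideanSpace.single i 1) =
        Γ x ^ 2 * (Φ x * fderiv ℝ Φ x (EuclideanSpace.single i 1)) := by simp only [ha_def]; ring
    rw [this, abs_mul, abs_pow]
    exact mul_le_mul_of_nonneg_right (pow_le_pow_left₀ (abs_nonneg _) (hM x) 2) (abs_nonneg _)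
  have hDab : ∀ i : Fin 3, Integrable (fun x => fderiv ℝ a x (EuclideanSpace.single i 1) * Φ x) volume := by
    intro i
    set e : EuclideanSpace ℝ (Fin 3) := EuclideanSpace.single i 1 with he
    have hc : ∀ x, |(x 0 * e 0 + x 1 * e 1) * Φ x| ≤ ‖u x‖ := fun x =>
      abs_horizPair_single_mul_angVelQuot_le hax hu2 x i
    have hdom : Integrable (fun x => 3 * M ^ 2 * |Φ x * fderiv ℝ Φ x e| + 4 * M * B * Φ x ^ 2) volume :=
      ((iΦD i).norm.const_mul _).add (iΦ2.const_mul _)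
    refine hdom.mono' (((ha1.continuous_fderiv one_ne_zero).clm_apply continuous_const).mul
      hΦc).aestronglyMeasurable (Eventually.of_forall fun x => ?_)
    rw [hDa x e, hDΓ x e, Real.norm_eq_abs]
    have e1 : (Γ x ^ 2 * fderiv ℝ Φ x e + Φ x * (2 * Γ x * (2 * (x 0 * e 0 + x 1 * e 1) * Φ x +
        (x 0 ^ 2 + x 1 ^ 2) * fderiv ℝ Φ x e))) * Φ x =
        3 * (Γ x ^ 2 * (Φ x * fderiv ℝ Φ x e)) + 4 * (Γ x * ((x 0 * e 0 + x 1 * e 1) * Φ x) * Φ x ^ 2) := by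
      rw [sq, hΓx x]; ring
    rw [e1]
    have t1 : |3 * (Γ x ^ 2 * (Φ x * fderiv ℝ Φ x e))| ≤ 3 * M ^ 2 * |Φ x * fderiv ℝ Φ x e| := by
      rw [abs_mul, abs_of_pos (by norm_num : (0:ℝ) < 3), abs_mul, abs_pow, mul_assoc]
      exact mul_le_mul_of_nonneg_left (mul_le_mul_of_nonneg_right
        (pow_le_pow_left₀ (abs_nonneg _) (hM x) 2) (abs_nonneg _)) (by norm_num)
    have t2 : |4 * (Γ x * ((x 0 * e 0 + x 1 * e 1) * Φ x) * Φ x ^ 2)| ≤ 4 * M * B * Φ x ^ 2 := by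
      rw [abs_mul, abs_of_pos (by norm_num : (0:ℝ) < 4), abs_mul, abs_mul, abs_of_nonneg (sq_nonneg (Φ x))]
      have := mul_le_mul (hM x) ((hc x).trans (huB x)) (abs_nonneg _) hM0
      have h4 : |Γ x| * |(x 0 * e 0 + x 1 * e 1) * Φ x| * Φ x ^ 2 ≤ M * B * Φ x ^ 2 :=
        mul_le_mul_of_nonneg_right this (sq_nonneg _)
      linarith
    calc |3 * (Γ x ^ 2 * (Φ x * fderiv ℝ Φ x e)) + 4 * (Γ x * ((x 0 * e 0 + x 1 * e 1) * Φ x) * Φ x ^ 2)|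
        ≤ |3 * (Γ x ^ 2 * (Φ x * fderiv ℝ Φ x e))| + |4 * (Γ x * ((x 0 * e 0 + x 1 * e 1) * Φ x) * Φ x ^ 2)| :=
          abs_add_le _ _
      _ ≤ 3 * M ^ 2 * |Φ x * fderiv ℝ Φ x e| + 4 * M * B * Φ x ^ 2 := add_le_add t1 t2
  -- the transport integration by parts
  have hT := integral_mul_fderiv_apply_eq_neg_of_isDivFree' ha1 hΦc1 hu1 hdiv huB hDu hab hDab haDb
  -- pointwise: `Da[u]·Φ = 3 a·DΦ[u] + 4 Γ² W Φ²`
  have hpt : ∀ x, fderiv ℝ a x (u x) * Φ x =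
      3 * (a x * fderiv ℝ Φ x (u x)) + 4 * (Γ x ^ 2 * W x * Φ x ^ 2) := by
    intro x
    rw [hDa x (u x), hDΓ x (u x), hxu x]
    simp only [ha_def]
    rw [sq, hΓx x]; ring
  -- integrability of the two pieces
  have iL : Integrable (fun x => a x * fderiv ℝ Φ x (u x)) volume := by
    have hdom : Integrable (fun x => M ^ 2 * B * (|Φ x * fderiv ℝ Φ x (EuclideanSpace.single 0 1)| +
        |Φ x * fderiv ℝ Φ x (EuclideanSpace.single 1 1)| + |Φ x * fderiv ℝ Φ x (EuclideanSpace.single 2 1)|))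
        volume := (((iΦD 0).norm.add (iΦD 1).norm).add (iΦD 2).norm).const_mul _
    refine hdom.mono' (ha1.continuous.mul (hDΦc.clm_apply hu.continuous)).aestronglyMeasurable
      (Eventually.of_forall fun x => ?_)
    rw [Real.norm_eq_abs, fderiv_apply_eq_sum_three Φ x (u x)]
    simp only [ha_def]
    have hui : ∀ i : Fin 3, |u x i| ≤ B := fun i => by
      have := PiLp.norm_apply_le (u x) i
      rw [Real.norm_eq_abs] at this
      exact this.trans (huB x)
    have hΓ2 : Γ x ^ 2 ≤ M ^ 2 := by rw [← sq_abs]; exact pow_le_pow_left₀ (abs_nonneg _) (hM x) 2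
    have key : ∀ i : Fin 3, |Γ x ^ 2 * Φ x * (u x i * fderiv ℝ Φ x (EuclideanSpace.single i 1))| ≤
        M ^ 2 * B * |Φ x * fderiv ℝ Φ x (EuclideanSpace.single i 1)| := by
      intro i
      have : Γ x ^ 2 * Φ x * (u x i * fderiv ℝ Φ x (EuclideanSpace.single i 1)) =
          Γ x ^ 2 * u x i * (Φ x * fderiv ℝ Φ x (EuclideanSpace.single i 1)) := by ring
      rw [this, abs_mul, abs_mul, abs_of_nonneg (sq_nonneg (Γ x))]
      exact mul_le_mul_of_nonneg_right (mul_le_mul hΓ2 (hui i) (abs_nonneg _) (sq_nonneg M))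
        (abs_nonneg _)
    have e1 : Γ x ^ 2 * Φ x * (u x 0 * fderiv ℝ Φ x (EuclideanSpace.single 0 1) +
        u x 1 * fderiv ℝ Φ x (EuclideanSpace.single 1 1) + u x 2 * fderiv ℝ Φ x (EuclideanSpace.single 2 1)) =
        Γ x ^ 2 * Φ x * (u x 0 * fderiv ℝ Φ x (EuclideanSpace.single 0 1)) +
        Γ x ^ 2 * Φ x * (u x 1 * fderiv ℝ Φ x (EuclideanSpace.single 1 1)) +
        Γ x ^ 2 * Φ x * (u x 2 * fderiv ℝ Φ x (EuclideanSpace.single 2 1)) := by ring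
    rw [e1]
    calc _ ≤ |Γ x ^ 2 * Φ x * (u x 0 * fderiv ℝ Φ x (EuclideanSpace.single 0 1))| +
          |Γ x ^ 2 * Φ x * (u x 1 * fderiv ℝ Φ x (EuclideanSpace.single 1 1))| +
          |Γ x ^ 2 * Φ x * (u x 2 * fderiv ℝ Φ x (EuclideanSpace.single 2 1))| := abs_add_three _ _ _
      _ ≤ M ^ 2 * B * |Φ x * fderiv ℝ Φ x (EuclideanSpace.single 0 1)| +
          M ^ 2 * B * |Φ x * fderiv ℝ Φ x (EuclideanSpace.single 1 1)| +
          M ^ 2 * B * |Φ x * fderiv ℝ Φ x (EuclideanSpace.single 2 1)| :=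
          add_le_add (add_le_add (key 0) (key 1)) (key 2)
      _ = _ := by ring
  have iW : Integrable (fun x => Γ x ^ 2 * W x * Φ x ^ 2) volume := by
    refine (iΦ2.const_mul (M ^ 2 * B')).mono' (((hΓc.pow 2).mul hWc).mul (hΦc.pow 2)).aestronglyMeasurable
      (Eventually.of_forall fun x => ?_)
    rw [Real.norm_eq_abs, abs_mul, abs_mul, abs_of_nonneg (sq_nonneg (Φ x)), abs_of_nonneg (sq_nonneg (Γ x))]
    have hΓ2 : Γ x ^ 2 ≤ M ^ 2 := by rw [← sq_abs]; exact pow_le_pow_left₀ (abs_nonneg _) (hM x) 2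
    exact mul_le_mul_of_nonneg_right (mul_le_mul hΓ2 (hWb x) (abs_nonneg _) (sq_nonneg M)) (sq_nonneg _)
  have hR : ∫ x, fderiv ℝ a x (u x) * Φ x =
      3 * (∫ x, a x * fderiv ℝ Φ x (u x)) + 4 * ∫ x, Γ x ^ 2 * W x * Φ x ^ 2 := by
    rw [integral_congr_ae (Eventually.of_forall hpt), integral_add (iL.const_mul 3) (iW.const_mul 4),
      integral_const_mul, integral_const_mul]
  rw [hR] at hT
  -- `hT : I = -(3 I + 4 Wint)`
  have : ∫ x, a x * fderiv ℝ Φ x (u x) = -∫ x, Γ x ^ 2 * W x * Φ x ^ 2 := by linarith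
  simpa only [ha_def] using this

/-- **Viscous term: `∫ Γ²Φ·ΔΦ = −4∫ Γ²Φ(∂ᵣΦ/r) − 3∫ Γ²|∇Φ|²`** (three whole-space integrations by
parts; `∇Γ·∇Φ = 2ρΦ(∂ᵣΦ/r) + ρ|∇Φ|²`). Hypotheses: `u ∈ C⁴` axisymmetric, `‖u‖ ≤ B`,
`|Γ| ≤ M`, `Φ, ∂ᵢΦ, ∂ᵢ∂ᵢΦ, radDerivQuot Φ ∈ L²`. [cite: LeiZhang2017, §3, p. 9] -/
theorem integral_swirl_sq_angVelQuot_laplacian (hax : IsAxisymmetric u) (hu : ContDiff ℝ 4 u)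
    {B : ℝ} (huB : ∀ x, ‖u x‖ ≤ B) {M : ℝ} (hM : ∀ x, |swirl u x| ≤ M)
    (hΦ0 : MemLp (angVelQuot u) 2 volume)
    (hΦ1 : ∀ i : Fin 3, MemLp (fun x => fderiv ℝ (angVelQuot u) x (EuclideanSpace.single i 1)) 2 volume)
    (hΦ2 : ∀ i : Fin 3, MemLp (fun x => fderiv ℝ (fun y => fderiv ℝ (angVelQuot u) y
      (EuclideanSpace.single i 1)) x (EuclideanSpace.single i 1)) 2 volume)
    (hq : MemLp (radDerivQuot (angVelQuot u)) 2 volume) :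
    ∫ x, swirl u x ^ 2 * angVelQuot u x * (Δ (angVelQuot u)) x =
      -4 * (∫ x, swirl u x ^ 2 * angVelQuot u x * radDerivQuot (angVelQuot u) x) -
        3 * ∫ x, swirl u x ^ 2 * (fderiv ℝ (angVelQuot u) x (EuclideanSpace.single 0 1) ^ 2 +
          fderiv ℝ (angVelQuot u) x (EuclideanSpace.single 1 1) ^ 2 +
          fderiv ℝ (angVelQuot u) x (EuclideanSpace.single 2 1) ^ 2) := by
  set Φ := angVelQuot u with hΦ
  set Γ := swirl u with hΓ
  set q := radDerivQuot Φ with hq_def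
  have hu2 : ContDiff ℝ 2 u := hu.of_le (by norm_cast)
  have hu3 : ContDiff ℝ 3 u := hu.of_le (by norm_cast)
  have hΦc2 : ContDiff ℝ 2 Φ := contDiff_angVelQuot (n := 2) (by exact_mod_cast hu)
  have hΦc1 : ContDiff ℝ 1 Φ := hΦc2.of_le (by norm_cast)
  have hΦd : Differentiable ℝ Φ := hΦc1.differentiable one_ne_zero
  have hΦc : Continuous Φ := hΦc1.continuous
  have hDΦc : Continuous (fderiv ℝ Φ) := hΦc1.continuous_fderiv one_ne_zero
  have hΓeq : Γ = fun x => (x 0 ^ 2 + x 1 ^ 2) * Φ x := swirl_eq_horizSq_mul_angVelQuot hax hu2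
  have hΓx : ∀ x, Γ x = (x 0 ^ 2 + x 1 ^ 2) * Φ x := fun x => by rw [hΓeq]
  have hΓc1 : ContDiff ℝ 1 Γ := by rw [hΓeq]; exact contDiff_horizSq.mul hΦc1
  have hΓd : Differentiable ℝ Γ := hΓc1.differentiable one_ne_zero
  have hΓc : Continuous Γ := hΓc1.continuous
  have hqc : Continuous q := (contDiff_radDerivQuot (n := 0) (by exact_mod_cast hΦc2)).continuous
  have hM0 : 0 ≤ M := (abs_nonneg _).trans (hM 0)
  have hB0 : 0 ≤ B := (norm_nonneg _).trans (huB 0)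
  have hDΓ : ∀ x h, fderiv ℝ Γ x h = 2 * (x 0 * h 0 + x 1 * h 1) * Φ x +
      (x 0 ^ 2 + x 1 ^ 2) * fderiv ℝ Φ x h := fun x h => fderiv_swirl_apply_eq hax hu3 x h
  have hxq : ∀ x, x 0 * fderiv ℝ Φ x (EuclideanSpace.single 0 1) +
      x 1 * fderiv ℝ Φ x (EuclideanSpace.single 1 1) = (x 0 ^ 2 + x 1 ^ 2) * q x :=
    fun x => coord_mul_fderiv_add_eq hax hu x
  -- the multiplier `a = Γ²Φ`
  set a : EuclideanSpace ℝ (Fin 3) → ℝ := fun x => Γ x ^ 2 * Φ x with ha_def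
  have ha1 : ContDiff ℝ 1 a := (hΓc1.pow 2).mul hΦc1
  have had : Differentiable ℝ a := ha1.differentiable one_ne_zero
  have hDa : ∀ x h, fderiv ℝ a x h = Γ x ^ 2 * fderiv ℝ Φ x h + Φ x * (2 * Γ x * fderiv ℝ Γ x h) := by
    intro x h
    have h1 := ((hΓd x).hasFDerivAt.pow 2).mul (hΦd x).hasFDerivAt
    rw [show a = (fun y => Γ y ^ 2) * Φ from rfl, h1.fderiv]
    simp only [_root_.add_apply, _root_.FunLike.coe_smul, Pi.smul_apply, smul_eq_mul]
    push_cast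
    ring
  -- building blocks
  have iΦD : ∀ i : Fin 3, Integrable (fun x => Φ x * fderiv ℝ Φ x (EuclideanSpace.single i 1)) volume :=
    fun i => hΦ0.integrable_mul (hΦ1 i)
  have iDD : ∀ i : Fin 3, Integrable (fun x => fderiv ℝ Φ x (EuclideanSpace.single i 1) ^ 2) volume :=
    fun i => (hΦ1 i).integrable_sq
  have iΦq : Integrable (fun x => Φ x * q x) volume := hΦ0.integrable_mul hq
  have hΓ2 : ∀ x, Γ x ^ 2 ≤ M ^ 2 := fun x => by
    rw [← sq_abs]; exact pow_le_pow_left₀ (abs_nonneg _) (hM x) 2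
  -- one integration by parts per coordinate
  have hIBP : ∀ i : Fin 3,
      ∫ x, a x * fderiv ℝ (fun y => fderiv ℝ Φ y (EuclideanSpace.single i 1)) x (EuclideanSpace.single i 1) =
        -∫ x, fderiv ℝ a x (EuclideanSpace.single i 1) * fderiv ℝ Φ x (EuclideanSpace.single i 1) := by
    intro i
    set e : EuclideanSpace ℝ (Fin 3) := EuclideanSpace.single i 1 with he
    set g : EuclideanSpace ℝ (Fin 3) → ℝ := fun y => fderiv ℝ Φ y e with hg
    have hg1 : ContDiff ℝ 1 g := contDiff_fderiv_apply_const_succ (n := 1) (by exact_mod_cast hΦc2) e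
    have hgd : Differentiable ℝ g := hg1.differentiable one_ne_zero
    have hgc : Continuous g := hg1.continuous
    have hc : ∀ x, |(x 0 * e 0 + x 1 * e 1) * Φ x| ≤ ‖u x‖ := fun x =>
      abs_horizPair_single_mul_angVelQuot_le hax hu2 x i
    -- integrability
    have i1 : Integrable (fun x => fderiv ℝ a x e * g x) volume := by
      have hdom : Integrable (fun x => 3 * M ^ 2 * g x ^ 2 + 4 * M * B * |Φ x * g x|) volume :=
        ((iDD i).const_mul _).add ((iΦD i).norm.const_mul _)
      refine hdom.mono' (((ha1.continuous_fderiv one_ne_zero).clm_apply continuous_const).mul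
        hgc).aestronglyMeasurable (Eventually.of_forall fun x => ?_)
      rw [hDa x e, hDΓ x e, Real.norm_eq_abs]
      have e1 : (Γ x ^ 2 * fderiv ℝ Φ x e + Φ x * (2 * Γ x * (2 * (x 0 * e 0 + x 1 * e 1) * Φ x +
          (x 0 ^ 2 + x 1 ^ 2) * fderiv ℝ Φ x e))) * g x =
          3 * (Γ x ^ 2 * g x ^ 2) + 4 * (Γ x * ((x 0 * e 0 + x 1 * e 1) * Φ x) * (Φ x * g x)) := by
        simp only [hg]; rw [sq (Γ x), hΓx x]; ring
      rw [e1]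
      have t1 : |3 * (Γ x ^ 2 * g x ^ 2)| ≤ 3 * M ^ 2 * g x ^ 2 := by
        rw [abs_of_nonneg (by positivity), mul_assoc]
        exact mul_le_mul_of_nonneg_left (mul_le_mul_of_nonneg_right (hΓ2 x) (sq_nonneg _)) (by norm_num)
      have t2 : |4 * (Γ x * ((x 0 * e 0 + x 1 * e 1) * Φ x) * (Φ x * g x))| ≤ 4 * M * B * |Φ x * g x| := by
        rw [abs_mul, abs_of_pos (by norm_num : (0:ℝ) < 4), abs_mul, abs_mul]
        have := mul_le_mul (hM x) ((hc x).trans (huB x)) (abs_nonneg _) hM0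
        have h4 : |Γ x| * |(x 0 * e 0 + x 1 * e 1) * Φ x| * |Φ x * g x| ≤ M * B * |Φ x * g x| :=
          mul_le_mul_of_nonneg_right this (abs_nonneg _)
        linarith
      calc |3 * (Γ x ^ 2 * g x ^ 2) + 4 * (Γ x * ((x 0 * e 0 + x 1 * e 1) * Φ x) * (Φ x * g x))|
          ≤ |3 * (Γ x ^ 2 * g x ^ 2)| + |4 * (Γ x * ((x 0 * e 0 + x 1 * e 1) * Φ x) * (Φ x * g x))| :=
            abs_add_le _ _
        _ ≤ 3 * M ^ 2 * g x ^ 2 + 4 * M * B * |Φ x * g x| := add_le_add t1 t2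
    have i2 : Integrable (fun x => a x * fderiv ℝ g x e) volume := by
      have hdom : Integrable (fun x => M ^ 2 * |Φ x * fderiv ℝ g x e|) volume :=
        (hΦ0.integrable_mul (hΦ2 i)).norm.const_mul _
      refine hdom.mono' (ha1.continuous.mul ((hg1.continuous_fderiv one_ne_zero).clm_apply
        continuous_const)).aestronglyMeasurable (Eventually.of_forall fun x => ?_)
      rw [Real.norm_eq_abs]
      have : a x * fderiv ℝ g x e = Γ x ^ 2 * (Φ x * fderiv ℝ g x e) := by simp only [ha_def]; ring
      rw [this, abs_mul, abs_of_nonneg (sq_nonneg (Γ x))]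
      exact mul_le_mul_of_nonneg_right (hΓ2 x) (abs_nonneg _)
    have i3 : Integrable (fun x => a x * g x) volume := by
      refine ((iΦD i).norm.const_mul (M ^ 2)).mono' (ha1.continuous.mul hgc).aestronglyMeasurable
        (Eventually.of_forall fun x => ?_)
      rw [Real.norm_eq_abs, Real.norm_eq_abs]
      have : a x * g x = Γ x ^ 2 * (Φ x * g x) := by simp only [ha_def]; ring
      rw [this, abs_mul, abs_of_nonneg (sq_nonneg (Γ x))]
      exact mul_le_mul_of_nonneg_right (hΓ2 x) (abs_nonneg _)
    exact integral_mul_fderiv_eq_neg_fderiv_mul_of_integrable (μ := volume) (f := a) (g := g) (v := e)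
      i1 i2 i3 (fun x _ => had x) (fun x _ => hgd x)
  -- the Laplacian as a sum
  have iJ : ∀ i : Fin 3, Integrable (fun x => a x *
      fderiv ℝ (fun y => fderiv ℝ Φ y (EuclideanSpace.single i 1)) x (EuclideanSpace.single i 1)) volume := by
    intro i
    have hg1 : ContDiff ℝ 1 fun y => fderiv ℝ Φ y (EuclideanSpace.single i 1) :=
      contDiff_fderiv_apply_const_succ (n := 1) (by exact_mod_cast hΦc2) _
    have hdom : Integrable (fun x => M ^ 2 * |Φ x *
        fderiv ℝ (fun y => fderiv ℝ Φ y (EuclideanSpace.single i 1)) x (EuclideanSpace.single i 1)|) volume :=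
      (hΦ0.integrable_mul (hΦ2 i)).norm.const_mul _
    refine hdom.mono' (ha1.continuous.mul ((hg1.continuous_fderiv one_ne_zero).clm_apply
      continuous_const)).aestronglyMeasurable (Eventually.of_forall fun x => ?_)
    rw [Real.norm_eq_abs]
    have : a x * fderiv ℝ (fun y => fderiv ℝ Φ y (EuclideanSpace.single i 1)) x (EuclideanSpace.single i 1) =
        Γ x ^ 2 * (Φ x * fderiv ℝ (fun y => fderiv ℝ Φ y (EuclideanSpace.single i 1)) x
          (EuclideanSpace.single i 1)) := by simp only [ha_def]; ring
    rw [this, abs_mul, abs_of_nonneg (sq_nonneg (Γ x))]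
    exact mul_le_mul_of_nonneg_right (hΓ2 x) (abs_nonneg _)
  have hlap : ∀ x, a x * (Δ Φ) x =
      a x * fderiv ℝ (fun y => fderiv ℝ Φ y (EuclideanSpace.single 0 1)) x (EuclideanSpace.single 0 1) +
      a x * fderiv ℝ (fun y => fderiv ℝ Φ y (EuclideanSpace.single 1 1)) x (EuclideanSpace.single 1 1) +
      a x * fderiv ℝ (fun y => fderiv ℝ Φ y (EuclideanSpace.single 2 1)) x (EuclideanSpace.single 2 1) := by
    intro x
    rw [laplacian_eq_sum_fderiv_fderiv (EuclideanSpace.basisFun (Fin 3) ℝ) hΦc2 x]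
    simp only [EuclideanSpace.basisFun_apply, Fin.sum_univ_three]
    ring
  -- the right side: `Σᵢ ∂ᵢa ∂ᵢΦ = 3 Γ² g2 + 4 Γ²Φ q`
  have iS : ∀ i : Fin 3, Integrable (fun x => fderiv ℝ a x (EuclideanSpace.single i 1) *
      fderiv ℝ Φ x (EuclideanSpace.single i 1)) volume := by
    -- as `i1` above
    intro i
    set e : EuclideanSpace ℝ (Fin 3) := EuclideanSpace.single i 1 with he
    have hc : ∀ x, |(x 0 * e 0 + x 1 * e 1) * Φ x| ≤ ‖u x‖ := fun x =>
      abs_horizPair_single_mul_angVelQuot_le hax hu2 x i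
    have hdom : Integrable (fun x => 3 * M ^ 2 * fderiv ℝ Φ x e ^ 2 + 4 * M * B * |Φ x * fderiv ℝ Φ x e|)
        volume := ((iDD i).const_mul _).add ((iΦD i).norm.const_mul _)
    refine hdom.mono' (((ha1.continuous_fderiv one_ne_zero).clm_apply continuous_const).mul
      (hDΦc.clm_apply continuous_const)).aestronglyMeasurable (Eventually.of_forall fun x => ?_)
    rw [hDa x e, hDΓ x e, Real.norm_eq_abs]
    have e1 : (Γ x ^ 2 * fderiv ℝ Φ x e + Φ x * (2 * Γ x * (2 * (x 0 * e 0 + x 1 * e 1) * Φ x +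
        (x 0 ^ 2 + x 1 ^ 2) * fderiv ℝ Φ x e))) * fderiv ℝ Φ x e =
        3 * (Γ x ^ 2 * fderiv ℝ Φ x e ^ 2) +
          4 * (Γ x * ((x 0 * e 0 + x 1 * e 1) * Φ x) * (Φ x * fderiv ℝ Φ x e)) := by
      rw [sq (Γ x), hΓx x]; ring
    rw [e1]
    have t1 : |3 * (Γ x ^ 2 * fderiv ℝ Φ x e ^ 2)| ≤ 3 * M ^ 2 * fderiv ℝ Φ x e ^ 2 := by
      rw [abs_of_nonneg (by positivity), mul_assoc]
      exact mul_le_mul_of_nonneg_left (mul_le_mul_of_nonneg_right (hΓ2 x) (sq_nonneg _)) (by norm_num)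
    have t2 : |4 * (Γ x * ((x 0 * e 0 + x 1 * e 1) * Φ x) * (Φ x * fderiv ℝ Φ x e))| ≤
        4 * M * B * |Φ x * fderiv ℝ Φ x e| := by
      rw [abs_mul, abs_of_pos (by norm_num : (0:ℝ) < 4), abs_mul, abs_mul]
      have := mul_le_mul (hM x) ((hc x).trans (huB x)) (abs_nonneg _) hM0
      have h4 : |Γ x| * |(x 0 * e 0 + x 1 * e 1) * Φ x| * |Φ x * fderiv ℝ Φ x e| ≤
          M * B * |Φ x * fderiv ℝ Φ x e| := mul_le_mul_of_nonneg_right this (abs_nonneg _)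
      linarith
    calc |3 * (Γ x ^ 2 * fderiv ℝ Φ x e ^ 2) + 4 * (Γ x * ((x 0 * e 0 + x 1 * e 1) * Φ x) * (Φ x * fderiv ℝ Φ x e))|
        ≤ |3 * (Γ x ^ 2 * fderiv ℝ Φ x e ^ 2)| +
            |4 * (Γ x * ((x 0 * e 0 + x 1 * e 1) * Φ x) * (Φ x * fderiv ℝ Φ x e))| := abs_add_le _ _
      _ ≤ 3 * M ^ 2 * fderiv ℝ Φ x e ^ 2 + 4 * M * B * |Φ x * fderiv ℝ Φ x e| := add_le_add t1 t2
  have hsum : ∀ x, fderiv ℝ a x (EuclideanSpace.single 0 1) * fderiv ℝ Φ x (EuclideanSpace.single 0 1) +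
      fderiv ℝ a x (EuclideanSpace.single 1 1) * fderiv ℝ Φ x (EuclideanSpace.single 1 1) +
      fderiv ℝ a x (EuclideanSpace.single 2 1) * fderiv ℝ Φ x (EuclideanSpace.single 2 1) =
      4 * (Γ x ^ 2 * Φ x * q x) + 3 * (Γ x ^ 2 * (fderiv ℝ Φ x (EuclideanSpace.single 0 1) ^ 2 +
        fderiv ℝ Φ x (EuclideanSpace.single 1 1) ^ 2 + fderiv ℝ Φ x (EuclideanSpace.single 2 1) ^ 2)) := by
    intro x
    rw [hDa, hDa, hDa, hDΓ, hDΓ, hDΓ]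
    simp only [PiLp.single_apply]
    simp only [Fin.isValue, ↓reduceIte, one_ne_zero, zero_ne_one, mul_one, mul_zero, add_zero, zero_add,
      zero_mul, Fin.reduceEq]
    have e1 : (Γ x ^ 2 * fderiv ℝ Φ x (EuclideanSpace.single 0 1) + Φ x * (2 * Γ x *
        (2 * x 0 * Φ x + (x 0 ^ 2 + x 1 ^ 2) * fderiv ℝ Φ x (EuclideanSpace.single 0 1)))) *
        fderiv ℝ Φ x (EuclideanSpace.single 0 1) +
        (Γ x ^ 2 * fderiv ℝ Φ x (EuclideanSpace.single 1 1) + Φ x * (2 * Γ x *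
        (2 * x 1 * Φ x + (x 0 ^ 2 + x 1 ^ 2) * fderiv ℝ Φ x (EuclideanSpace.single 1 1)))) *
        fderiv ℝ Φ x (EuclideanSpace.single 1 1) +
        (Γ x ^ 2 * fderiv ℝ Φ x (EuclideanSpace.single 2 1) + Φ x * (2 * Γ x *
        ((x 0 ^ 2 + x 1 ^ 2) * fderiv ℝ Φ x (EuclideanSpace.single 2 1)))) *
        fderiv ℝ Φ x (EuclideanSpace.single 2 1) =
        4 * Γ x * Φ x ^ 2 * (x 0 * fderiv ℝ Φ x (EuclideanSpace.single 0 1) +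
          x 1 * fderiv ℝ Φ x (EuclideanSpace.single 1 1)) +
        (Γ x ^ 2 + 2 * Γ x * Φ x * (x 0 ^ 2 + x 1 ^ 2)) * (fderiv ℝ Φ x (EuclideanSpace.single 0 1) ^ 2 +
          fderiv ℝ Φ x (EuclideanSpace.single 1 1) ^ 2 + fderiv ℝ Φ x (EuclideanSpace.single 2 1) ^ 2) := by
      ring
    rw [e1, hxq x, sq (Γ x), hΓx x]
    ring
  -- integrate
  have iS01 : Integrable (fun x => fderiv ℝ a x (EuclideanSpace.single 0 1) * fderiv ℝ Φ x (EuclideanSpace.single 0 1) +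
      fderiv ℝ a x (EuclideanSpace.single 1 1) * fderiv ℝ Φ x (EuclideanSpace.single 1 1)) volume :=
    (iS 0).add (iS 1)
  have iJ01 : Integrable (fun x =>
      a x * fderiv ℝ (fun y => fderiv ℝ Φ y (EuclideanSpace.single 0 1)) x (EuclideanSpace.single 0 1) +
      a x * fderiv ℝ (fun y => fderiv ℝ Φ y (EuclideanSpace.single 1 1)) x (EuclideanSpace.single 1 1))
      volume := (iJ 0).add (iJ 1)
  have ig2 : Integrable (fun x => fderiv ℝ Φ x (EuclideanSpace.single 0 1) ^ 2 +
      fderiv ℝ Φ x (EuclideanSpace.single 1 1) ^ 2 + fderiv ℝ Φ x (EuclideanSpace.single 2 1) ^ 2) volume :=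
    ((iDD 0).add (iDD 1)).add (iDD 2)
  have iD : Integrable (fun x => Γ x ^ 2 * (fderiv ℝ Φ x (EuclideanSpace.single 0 1) ^ 2 +
      fderiv ℝ Φ x (EuclideanSpace.single 1 1) ^ 2 + fderiv ℝ Φ x (EuclideanSpace.single 2 1) ^ 2)) volume := by
    refine (ig2.const_mul (M ^ 2)).mono' ((hΓc.pow 2).mul (by fun_prop)).aestronglyMeasurable
      (Eventually.of_forall fun x => ?_)
    have hg0 : 0 ≤ fderiv ℝ Φ x (EuclideanSpace.single 0 1) ^ 2 +
        fderiv ℝ Φ x (EuclideanSpace.single 1 1) ^ 2 + fderiv ℝ Φ x (EuclideanSpace.single 2 1) ^ 2 := by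
      positivity
    rw [Real.norm_eq_abs, abs_mul, abs_of_nonneg hg0, abs_of_nonneg (sq_nonneg (Γ x))]
    exact mul_le_mul_of_nonneg_right (hΓ2 x) hg0
  have iX : Integrable (fun x => Γ x ^ 2 * Φ x * q x) volume := by
    refine ((iΦq.norm).const_mul (M ^ 2)).mono'
      (((hΓc.pow 2).mul hΦc).mul hqc).aestronglyMeasurable (Eventually.of_forall fun x => ?_)
    rw [Real.norm_eq_abs, Real.norm_eq_abs, mul_assoc, abs_mul, abs_of_nonneg (sq_nonneg (Γ x))]
    exact mul_le_mul_of_nonneg_right (hΓ2 x) (abs_nonneg _)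
  have eS : ∫ x, (fderiv ℝ a x (EuclideanSpace.single 0 1) * fderiv ℝ Φ x (EuclideanSpace.single 0 1) +
      fderiv ℝ a x (EuclideanSpace.single 1 1) * fderiv ℝ Φ x (EuclideanSpace.single 1 1) +
      fderiv ℝ a x (EuclideanSpace.single 2 1) * fderiv ℝ Φ x (EuclideanSpace.single 2 1)) =
      4 * (∫ x, Γ x ^ 2 * Φ x * q x) + 3 * ∫ x, Γ x ^ 2 * (fderiv ℝ Φ x (EuclideanSpace.single 0 1) ^ 2 +
        fderiv ℝ Φ x (EuclideanSpace.single 1 1) ^ 2 + fderiv ℝ Φ x (EuclideanSpace.single 2 1) ^ 2) := by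
    rw [integral_congr_ae (Eventually.of_forall hsum), integral_add (iX.const_mul 4) (iD.const_mul 3),
      integral_const_mul, integral_const_mul]
  calc ∫ x, a x * (Δ Φ) x
      = ∫ x, (a x * fderiv ℝ (fun y => fderiv ℝ Φ y (EuclideanSpace.single 0 1)) x (EuclideanSpace.single 0 1) +
          a x * fderiv ℝ (fun y => fderiv ℝ Φ y (EuclideanSpace.single 1 1)) x (EuclideanSpace.single 1 1) +
          a x * fderiv ℝ (fun y => fderiv ℝ Φ y (EuclideanSpace.single 2 1)) x (EuclideanSpace.single 2 1)) :=
        integral_congr_ae (Eventually.of_forall hlap)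
    _ = -(∫ x, (fderiv ℝ a x (EuclideanSpace.single 0 1) * fderiv ℝ Φ x (EuclideanSpace.single 0 1) +
          fderiv ℝ a x (EuclideanSpace.single 1 1) * fderiv ℝ Φ x (EuclideanSpace.single 1 1) +
          fderiv ℝ a x (EuclideanSpace.single 2 1) * fderiv ℝ Φ x (EuclideanSpace.single 2 1))) := by
        rw [integral_add iJ01 (iJ 2), integral_add (iJ 0) (iJ 1), hIBP 0, hIBP 1, hIBP 2,
          integral_add iS01 (iS 2), integral_add (iS 0) (iS 1)]
        ring
    _ = _ := by rw [eS]; ring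

/-- Integrability of the terms of the `L⁴` estimate: `Γ²Φ(∂ᵣΦ/r)`, `ΓΦ³`, `Γ²|∇Φ|²`, `Γ²WΦ²`,
`Γ²Φ²`, `Γ²Φ·DΦ[u]` (`u ∈ C⁴` axisymmetric, `‖u‖ ≤ B`, `‖Du‖ ≤ B'`, `|Γ| ≤ M`,
`Φ, ∂ᵢΦ, radDerivQuot Φ ∈ L²`). [folklore] -/
theorem integrable_swirl_L4_terms (hax : IsAxisymmetric u) (hu : ContDiff ℝ 4 u)
    {B : ℝ} (huB : ∀ x, ‖u x‖ ≤ B) {B' : ℝ} (hDu : ∀ x, ‖fderiv ℝ u x‖ ≤ B')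
    {M : ℝ} (hM : ∀ x, |swirl u x| ≤ M)
    (hΦ0 : MemLp (angVelQuot u) 2 volume)
    (hΦ1 : ∀ i : Fin 3, MemLp (fun x => fderiv ℝ (angVelQuot u) x (EuclideanSpace.single i 1)) 2 volume)
    (hq : MemLp (radDerivQuot (angVelQuot u)) 2 volume) :
    Integrable (fun x => swirl u x ^ 2 * angVelQuot u x * radDerivQuot (angVelQuot u) x) ∧
    Integrable (fun x => swirl u x * angVelQuot u x ^ 3) ∧
    Integrable (fun x => swirl u x ^ 2 * (fderiv ℝ (angVelQuot u) x (EuclideanSpace.single 0 1) ^ 2 +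
      fderiv ℝ (angVelQuot u) x (EuclideanSpace.single 1 1) ^ 2 +
      fderiv ℝ (angVelQuot u) x (EuclideanSpace.single 2 1) ^ 2)) ∧
    Integrable (fun x => swirl u x ^ 2 * radVelQuot u x * angVelQuot u x ^ 2) ∧
    Integrable (fun x => swirl u x ^ 2 * angVelQuot u x ^ 2) ∧
    Integrable (fun x => swirl u x ^ 2 * angVelQuot u x * fderiv ℝ (angVelQuot u) x (u x)) := by
  set Φ := angVelQuot u with hΦ
  set Γ := swirl u with hΓ
  set q := radDerivQuot Φ with hq_def
  set W := radVelQuot u with hW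
  have hu2 : ContDiff ℝ 2 u := hu.of_le (by norm_cast)
  have hu3 : ContDiff ℝ 3 u := hu.of_le (by norm_cast)
  have hΦc2 : ContDiff ℝ 2 Φ := contDiff_angVelQuot (n := 2) (by exact_mod_cast hu)
  have hΦc1 : ContDiff ℝ 1 Φ := hΦc2.of_le (by norm_cast)
  have hΦc : Continuous Φ := hΦc1.continuous
  have hDΦc : Continuous (fderiv ℝ Φ) := hΦc1.continuous_fderiv one_ne_zero
  have hΓeq : Γ = fun x => (x 0 ^ 2 + x 1 ^ 2) * Φ x := swirl_eq_horizSq_mul_angVelQuot hax hu2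
  have hΓc : Continuous Γ := by rw [hΓeq]; exact (contDiff_horizSq (n := 0)).continuous.mul hΦc
  have hqc : Continuous q := (contDiff_radDerivQuot (n := 0) (by exact_mod_cast hΦc2)).continuous
  have hWc : Continuous W := (contDiff_radVelQuot (n := 0) (by exact_mod_cast hu2)).continuous
  have hM0 : 0 ≤ M := (abs_nonneg _).trans (hM 0)
  have hB'0 : 0 ≤ B' := (norm_nonneg _).trans (hDu 0)
  have hΦb : ∀ x, |Φ x| ≤ B' := fun x => (hax.abs_angVelQuot_le_norm_fderiv hu2 x).trans (hDu x)
  have hWb : ∀ x, |W x| ≤ B' := fun x => (hax.abs_radVelQuot_le_norm_fderiv hu2 x).trans (hDu x)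
  have hΓ2 : ∀ x, Γ x ^ 2 ≤ M ^ 2 := fun x => by
    rw [← sq_abs]; exact pow_le_pow_left₀ (abs_nonneg _) (hM x) 2
  have iΦ2 : Integrable (fun x => Φ x ^ 2) volume := hΦ0.integrable_sq
  have iΦD : ∀ i : Fin 3, Integrable (fun x => Φ x * fderiv ℝ Φ x (EuclideanSpace.single i 1)) volume :=
    fun i => hΦ0.integrable_mul (hΦ1 i)
  have iDD : ∀ i : Fin 3, Integrable (fun x => fderiv ℝ Φ x (EuclideanSpace.single i 1) ^ 2) volume :=
    fun i => (hΦ1 i).integrable_sq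
  have iΦq : Integrable (fun x => Φ x * q x) volume := hΦ0.integrable_mul hq
  refine ⟨?_, ?_, ?_, ?_, ?_, ?_⟩
  · refine ((iΦq.norm).const_mul (M ^ 2)).mono'
      (((hΓc.pow 2).mul hΦc).mul hqc).aestronglyMeasurable (Eventually.of_forall fun x => ?_)
    rw [Real.norm_eq_abs, Real.norm_eq_abs, mul_assoc, abs_mul, abs_of_nonneg (sq_nonneg (Γ x))]
    exact mul_le_mul_of_nonneg_right (hΓ2 x) (abs_nonneg _)
  · refine ((iΦ2).const_mul (M * B')).mono' ((hΓc.mul (hΦc.pow 3))).aestronglyMeasurable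
      (Eventually.of_forall fun x => ?_)
    rw [Real.norm_eq_abs, abs_mul, abs_pow]
    have : |Φ x| ^ 3 = |Φ x| * Φ x ^ 2 := by rw [← sq_abs]; ring
    rw [this]
    calc |Γ x| * (|Φ x| * Φ x ^ 2) = (|Γ x| * |Φ x|) * Φ x ^ 2 := by ring
      _ ≤ (M * B') * Φ x ^ 2 :=
          mul_le_mul_of_nonneg_right (mul_le_mul (hM x) (hΦb x) (abs_nonneg _) hM0) (sq_nonneg _)
  · have ig2 : Integrable (fun x => fderiv ℝ Φ x (EuclideanSpace.single 0 1) ^ 2 +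
        fderiv ℝ Φ x (EuclideanSpace.single 1 1) ^ 2 + fderiv ℝ Φ x (EuclideanSpace.single 2 1) ^ 2) volume :=
      ((iDD 0).add (iDD 1)).add (iDD 2)
    refine (ig2.const_mul (M ^ 2)).mono' ((hΓc.pow 2).mul (by fun_prop)).aestronglyMeasurable
      (Eventually.of_forall fun x => ?_)
    have hg0 : 0 ≤ fderiv ℝ Φ x (EuclideanSpace.single 0 1) ^ 2 +
        fderiv ℝ Φ x (EuclideanSpace.single 1 1) ^ 2 + fderiv ℝ Φ x (EuclideanSpace.single 2 1) ^ 2 := by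
      positivity
    rw [Real.norm_eq_abs, abs_mul, abs_of_nonneg hg0, abs_of_nonneg (sq_nonneg (Γ x))]
    exact mul_le_mul_of_nonneg_right (hΓ2 x) hg0
  · refine (iΦ2.const_mul (M ^ 2 * B')).mono' (((hΓc.pow 2).mul hWc).mul (hΦc.pow 2)).aestronglyMeasurable
      (Eventually.of_forall fun x => ?_)
    rw [Real.norm_eq_abs, abs_mul, abs_mul, abs_of_nonneg (sq_nonneg (Φ x)), abs_of_nonneg (sq_nonneg (Γ x))]
    exact mul_le_mul_of_nonneg_right (mul_le_mul (hΓ2 x) (hWb x) (abs_nonneg _) (sq_nonneg M)) (sq_nonneg _)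
  · refine (iΦ2.const_mul (M ^ 2)).mono' ((hΓc.pow 2).mul (hΦc.pow 2)).aestronglyMeasurable
      (Eventually.of_forall fun x => ?_)
    rw [Real.norm_eq_abs, abs_mul, abs_of_nonneg (sq_nonneg (Φ x)), abs_of_nonneg (sq_nonneg (Γ x))]
    exact mul_le_mul_of_nonneg_right (hΓ2 x) (sq_nonneg _)
  · have hB0 : 0 ≤ B := (norm_nonneg _).trans (huB 0)
    have hdom : Integrable (fun x => M ^ 2 * B * (|Φ x * fderiv ℝ Φ x (EuclideanSpace.single 0 1)| +
        |Φ x * fderiv ℝ Φ x (EuclideanSpace.single 1 1)| + |Φ x * fderiv ℝ Φ x (EuclideanSpace.single 2 1)|))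
        volume := (((iΦD 0).norm.add (iΦD 1).norm).add (iΦD 2).norm).const_mul _
    refine hdom.mono' (((hΓc.pow 2).mul hΦc).mul (hDΦc.clm_apply hu.continuous)).aestronglyMeasurable
      (Eventually.of_forall fun x => ?_)
    rw [Real.norm_eq_abs, fderiv_apply_eq_sum_three Φ x (u x)]
    have hui : ∀ i : Fin 3, |u x i| ≤ B := fun i => by
      have := PiLp.norm_apply_le (u x) i
      rw [Real.norm_eq_abs] at this
      exact this.trans (huB x)
    have key : ∀ i : Fin 3, |Γ x ^ 2 * Φ x * (u x i * fderiv ℝ Φ x (EuclideanSpace.single i 1))| ≤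
        M ^ 2 * B * |Φ x * fderiv ℝ Φ x (EuclideanSpace.single i 1)| := by
      intro i
      have : Γ x ^ 2 * Φ x * (u x i * fderiv ℝ Φ x (EuclideanSpace.single i 1)) =
          Γ x ^ 2 * u x i * (Φ x * fderiv ℝ Φ x (EuclideanSpace.single i 1)) := by ring
      rw [this, abs_mul, abs_mul, abs_of_nonneg (sq_nonneg (Γ x))]
      exact mul_le_mul_of_nonneg_right (mul_le_mul (hΓ2 x) (hui i) (abs_nonneg _) (sq_nonneg M))
        (abs_nonneg _)
    have e1 : Γ x ^ 2 * Φ x * (u x 0 * fderiv ℝ Φ x (EuclideanSpace.single 0 1) +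
        u x 1 * fderiv ℝ Φ x (EuclideanSpace.single 1 1) + u x 2 * fderiv ℝ Φ x (EuclideanSpace.single 2 1)) =
        Γ x ^ 2 * Φ x * (u x 0 * fderiv ℝ Φ x (EuclideanSpace.single 0 1)) +
        Γ x ^ 2 * Φ x * (u x 1 * fderiv ℝ Φ x (EuclideanSpace.single 1 1)) +
        Γ x ^ 2 * Φ x * (u x 2 * fderiv ℝ Φ x (EuclideanSpace.single 2 1)) := by ring
    rw [e1]
    calc _ ≤ |Γ x ^ 2 * Φ x * (u x 0 * fderiv ℝ Φ x (EuclideanSpace.single 0 1))| +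
          |Γ x ^ 2 * Φ x * (u x 1 * fderiv ℝ Φ x (EuclideanSpace.single 1 1))| +
          |Γ x ^ 2 * Φ x * (u x 2 * fderiv ℝ Φ x (EuclideanSpace.single 2 1))| := abs_add_three _ _ _
      _ ≤ M ^ 2 * B * |Φ x * fderiv ℝ Φ x (EuclideanSpace.single 0 1)| +
          M ^ 2 * B * |Φ x * fderiv ℝ Φ x (EuclideanSpace.single 1 1)| +
          M ^ 2 * B * |Φ x * fderiv ℝ Φ x (EuclideanSpace.single 2 1)| :=
          add_le_add (add_le_add (key 0) (key 1)) (key 2)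
      _ = _ := by ring

end Integral

end LeiZhang2017

end Literature.Analysis.FluidPDE
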